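import Literature.MathematicalPhysics.KineticTheory.TaggedSphereSpectralGap
import HarnessLib

/-!
# The Hilbert expansion of BGSR on one Fourier mode: correctors, Dirichlet form, energy estimate
(Bodineau–Gallagher–Saint-Raymond, Invent. Math. 203 (2016) = arXiv:1305.3397v2, §6.1.2–6.1.3,
(6.4)–(6.9); the core layer of the bottom-up proof of the named fact
`Literature.MathematicalPhysics.KineticTheory.bgsr_hydrodynamicLimit` of `TaggedSphereDiffusion`)

On the Fourier mode `e_n(x) = exp(2πi n·x)` the linear Boltzmann equation (1.3) at inverse mean
free path `α`, rescaled to diffusive times `t = ατ`, becomes the velocity-only equation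
`∂_τ G = -(α² a_β + i α ω) G + α² K⁺_β G`, `G(0) = 1`, with the *mode frequency*
`ω(v) = 2π n·v` and `L = a_β - K⁺_β` (Carleman form, `TaggedSphereCarleman`). The Hilbert expansion of
BGSR §6.1.2 reads `G ≈ Ψ = e^{-λτ}(1 - i α⁻¹ ω_b)` with

* the *mode corrector* `ω_b = 2π n·b`, `b` the diffusion corrector of (6.5), so that `L ω_b = ω`
  (`ae_sub_carlemanGain_modeCorrector`);
* the *mode rate* `λ = 4π² κ_β |n|² = ∫ ω ω_b M_β` (`integral_modeFreq_mul_modeCorrector`, the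
  isotropy (6.8) proved in `TaggedSphereSpectralGap`);
* a *second mode corrector* `D` with `L D = ω ω_b - λ` (`exists_secondModeCorrector`, the
  contraction of the second correctors (6.7) of `TaggedSphereDiffusionCorrector` with `2πn ⊗ 2πn`).

**Main result** (`IsModePair.modeEnergy_le`). For `d ≥ 2`, `β > 0`, a corrector `b`, a frequency
`n` and `T ≥ 0` there is `C = C(d, β, b, n, T)` such that for every `α ≥ 1` and every solution
`G = P + iQ` of the mode equation with `G(0) = 1`, `|G| ≤ 1` (measurable in `v`, continuous in
`τ`, differentiable in `τ > 0`; the hypothesis bundle `IsModePair`),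
`y(τ) := ‖G(τ) - Ψ(τ)‖²_{L²(M_β dv)} ≤ C / α²` on `[0, T]`. This is the `L²(M_β)` form of the
maximum-principle step of BGSR §6.1.3 (whose printed `M_β`-weighted `L^∞` version does not hold
uniformly in `α`); it only uses that `b` and `D` have finite energy `∫ g² a_β M_β < ∞`.

## The proof

1. *Linearity of `L` where it converges* (`sub_carlemanGain_sum_ae`) and the algebra of the
   Dirichlet form `B(g, h) = ∫ g h a_β M_β - Q_β(g, h) = ∫ (a_β g - K⁺ g) h M_β`
   (`dirichletForm` of `TaggedSphereSpectralGap`) on finite-energy functions: symmetry, bilinearity,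
   `B ≥ 0`, and the absorption inequality `|B(g, h)| ≤ (ε B(g,g) + ε⁻¹ B(h,h))/2`
   (`abs_dirichletForm_le`, completing the square).
2. *The pointwise energy identity* (`IsModePair.ae_energy_identity`): with `E = e^{-λτ}`,
   `p = P - E`, `q = Q + E ω_b/α`, a.e. in `v`,
   `p ∂p + q ∂q = -α² (p (a p - K⁺p) + q (a q - K⁺q)) - E p (a D - K⁺D) - (λE/α) q ω_b`:
   the transport terms `αω(Qp - Pq)` are exactly cancelled by `L ω_b = ω` and `L D = ω ω_b - λ`
   (a `field_simp; ring` identity once the corrector equations are substituted).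
3. *Integration* (`IsModePair.integral_energy_identity`):
   `∫ (p∂p + q∂q) M_β = -α²(B(p,p) + B(q,q)) - E B(D,p) - (λE/α) ∫ q ω_b M_β`.
4. *The energy is `C¹` in `τ > 0` and continuous on `[0, T]`* (`hasDerivAt_modeEnergy`,
   `continuousOn_modeEnergy`): differentiation under the integral, dominated by
   `4A(2 + ω_b²) a_β M_β` (`exists_bounds`; `|K⁺G| ≤ a_β`, `|ω| ≤ C a_β`, `a_β ≥ a₀`).
5. *The differential inequality* (`integral_energyDensityDeriv_le`):
   `y' ≤ λ y + (B(D,D)/2 + λ ∫ ω_b² M_β)/α²`, absorbing `-2E B(D,p)` into `-2α² B(p,p)` with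
   `ε = (2α²)⁻¹` and bounding `(2λE/α)∫ q ω_b M_β ≤ λ ∫ q² M_β + λ α⁻² ∫ ω_b² M_β`.
6. *Grönwall* on `[a, T]` and `a → 0⁺` (`modeEnergy_le_gronwallBound`), with
   `y(0) = α⁻² ∫ ω_b² M_β`, and `gronwallBound δ K ε x ≤ (δ + εx) e^{Kx}`.

What remains for (6.3) (see `TaggedSphereHydrodynamicModes`, `TaggedSphereCarlemanMoment`): the mode
amplitude of the collision series satisfies `IsModePair` (Duhamel form ⇒ pointwise ODE), and the
`L²(M_β) → M_β`-weighted sup step through one Duhamel iteration with the kernel-moment split.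

## References

* T. Bodineau, I. Gallagher, L. Saint-Raymond, *The Brownian motion as the limit of a
  deterministic system of hard-spheres*, Invent. Math. 203 (2016) 493–553 = arXiv:1305.3397v2,
  §6.1.2–6.1.3, (6.4)–(6.10).
* A. Bensoussan, J.-L. Lions, G. Papanicolaou, *Boundary layers and homogenization of transport
  processes*, Publ. RIMS 15 (1979) 53–157 (BGSR's [6]).
-/

open MeasureTheory Metric Set Filter Topology ProbabilityTheory
open scoped InnerProductSpace ENNReal NNReal

namespace Literature.MathematicalPhysics.KineticTheory

noncomputable section

open Literature.Analysis.FunctionSpaces (maxwellianBeta maxwellianBeta_pos)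
open TaggedSphereDiffusion (collisionFrequency)

variable {d : Type*} [Fintype d] {β : ℝ}

local notation "𝔼" => EuclideanSpace ℝ d

/-! ## Linearity of the Carleman gain operator where it converges -/

section GainLinear

variable (hd : 2 ≤ Fintype.card d) (hβ : 0 < β)

/-- Homogeneity of `K⁺_β` (exact). [folklore] -/
theorem carlemanGain_const_mul (β c : ℝ) (g : 𝔼 → ℝ) (v : 𝔼) :
    carlemanGain β (fun w => c * g w) v = c * carlemanGain β g v := by
  rw [carlemanGain, carlemanGain, ← integral_const_mul]
  refine integral_congr_ae (Eventually.of_forall fun u => ?_)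
  ring

/-- Additivity of `K⁺_β` where both Carleman integrals converge. [folklore] -/
theorem carlemanGain_add_of_integrable (β : ℝ) {g h : 𝔼 → ℝ} (v : 𝔼)
    (hg : Integrable fun u => carlemanKernel β v u * g (v + u))
    (hh : Integrable fun u => carlemanKernel β v u * h (v + u)) :
    carlemanGain β (fun w => g w + h w) v = carlemanGain β g v + carlemanGain β h v := by
  rw [carlemanGain, carlemanGain, carlemanGain, ← integral_add hg hh]
  refine integral_congr_ae (Eventually.of_forall fun u => ?_)
  ring

include hd hβ in
/-- **`K⁺_β` is additive a.e. on finite-energy functions.** [folklore] -/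
theorem carlemanGain_add_ae {g h : 𝔼 → ℝ} (hg : FiniteEnergy β g) (hh : FiniteEnergy β h) :
    ∀ᵐ v : 𝔼, carlemanGain β (fun w => g w + h w) v = carlemanGain β g v + carlemanGain β h v := by
  filter_upwards [ae_integrable_carlemanKernel_mul hd hβ hg.measurable hg.integrable,
    ae_integrable_carlemanKernel_mul hd hβ hh.measurable hh.integrable] with v h1 h2
  exact carlemanGain_add_of_integrable β v h1 h2

/-- Finite energy is preserved under sums. [folklore] -/
theorem FiniteEnergy.add' {g h : 𝔼 → ℝ} (hg : FiniteEnergy β g) (hh : FiniteEnergy β h) (hβ : 0 < β) :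
    FiniteEnergy β (fun v => g v + h v) := by
  refine ⟨hg.measurable.add hh.measurable, ?_⟩
  refine ((hg.integrable.add hh.integrable).const_mul 2).mono'
    ((((hg.measurable.add hh.measurable).pow_const 2).mul (continuous_collisionFrequency hβ).measurable).mul
      (measurable_maxwellianBeta β)).aestronglyMeasurable (Eventually.of_forall fun v => ?_)
  have ha := TaggedLinearBoltzmannSeries.collisionFrequency_nonneg hβ v
  have hM := (maxwellianBeta_pos hβ v).le
  rw [Real.norm_of_nonneg (mul_nonneg (mul_nonneg (sq_nonneg _) ha) hM)]
  simp only [Pi.add_apply]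
  have h2 : (g v + h v) ^ 2 ≤ 2 * (g v ^ 2 + h v ^ 2) := by nlinarith [sq_nonneg (g v - h v)]
  calc (g v + h v) ^ 2 * collisionFrequency β v * maxwellianBeta β v
      ≤ 2 * (g v ^ 2 + h v ^ 2) * collisionFrequency β v * maxwellianBeta β v := by gcongr
    _ = 2 * (g v ^ 2 * collisionFrequency β v * maxwellianBeta β v +
          h v ^ 2 * collisionFrequency β v * maxwellianBeta β v) := by ring

/-- Finite energy is preserved under scalar multiples. [folklore] -/
theorem FiniteEnergy.const_mul' {g : 𝔼 → ℝ} (hg : FiniteEnergy β g) (c : ℝ) :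
    FiniteEnergy β (fun v => c * g v) :=
  ⟨hg.measurable.const_mul c, (hg.integrable.const_mul (c ^ 2)).congr (Eventually.of_forall fun v => by ring)⟩

/-- Finite energy is preserved under finite linear combinations. [folklore] -/
theorem finiteEnergy_sum (hβ : 0 < β) {ι : Type*} (S : Finset ι) {g : ι → 𝔼 → ℝ}
    (hg : ∀ i, FiniteEnergy β (g i)) (c : ι → ℝ) :
    FiniteEnergy β (fun v => ∑ i ∈ S, c i * g i v) := by
  classical
  induction S using Finset.induction_on with
  | empty =>
    simp only [Finset.sum_empty]
    exact finiteEnergy_const hβ 0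
  | insert a S ha ih =>
    simp only [Finset.sum_insert ha]
    exact ((hg a).const_mul' (c a)).add' ih hβ

include hd hβ in
/-- **`a_β · - K⁺_β` is linear a.e. over finite combinations** of finite-energy functions.
[folklore] -/
theorem sub_carlemanGain_sum_ae {ι : Type*} (S : Finset ι) {g : ι → 𝔼 → ℝ}
    (hg : ∀ i, FiniteEnergy β (g i)) (c : ι → ℝ) :
    ∀ᵐ v : 𝔼, collisionFrequency β v * (∑ i ∈ S, c i * g i v) - carlemanGain β (fun w => ∑ i ∈ S, c i * g i w) v =
      ∑ i ∈ S, c i * (collisionFrequency β v * g i v - carlemanGain β (g i) v) := by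
  classical
  induction S using Finset.induction_on with
  | empty =>
    refine Eventually.of_forall fun v => ?_
    simp [carlemanGain]
  | insert a S ha ih =>
    have hS := finiteEnergy_sum hβ S hg c
    filter_upwards [ih, carlemanGain_add_ae hd hβ ((hg a).const_mul' (c a)) hS] with v hv hadd
    simp only [Finset.sum_insert ha]
    rw [hadd, carlemanGain_const_mul]
    linear_combination hv

end GainLinear

/-! ## The algebra of the Dirichlet form on finite-energy functions -/

section DirichletAlgebra

variable (hd : 2 ≤ Fintype.card d) (hβ : 0 < β)

include hβ in
/-- `g h a_β M_β` is integrable for `g, h` of finite energy (`2|gh| ≤ g² + h²`). [folklore] -/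
theorem FiniteEnergy.integrable_mul_mul {g h : 𝔼 → ℝ} (hg : FiniteEnergy β g) (hh : FiniteEnergy β h) :
    Integrable fun v => g v * h v * (collisionFrequency β v * maxwellianBeta β v) := by
  refine ((hg.integrable.add hh.integrable).div_const 2).mono'
    (((hg.measurable.mul hh.measurable).mul ((continuous_collisionFrequency hβ).measurable.mul
      (measurable_maxwellianBeta β))).aestronglyMeasurable) (Eventually.of_forall fun v => ?_)
  have hw : 0 ≤ collisionFrequency β v * maxwellianBeta β v :=
    mul_nonneg (TaggedLinearBoltzmannSeries.collisionFrequency_nonneg hβ v) (maxwellianBeta_pos hβ v).le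
  rw [Real.norm_eq_abs, abs_mul, abs_of_nonneg hw, abs_mul]
  simp only [Pi.add_apply]
  rw [le_div_iff₀ two_pos]
  nlinarith [mul_nonneg (mul_self_nonneg (|g v| - |h v|)) hw, sq_abs (g v), sq_abs (h v)]

include hβ in
/-- **Symmetry of the Dirichlet form** (detailed balance). [folklore] -/
theorem dirichletForm_comm (g h : 𝔼 → ℝ) : dirichletForm β g h = dirichletForm β h g := by
  rw [dirichletForm, dirichletForm, carlemanForm_comm hβ]
  congr 1
  refine integral_congr_ae (Eventually.of_forall fun v => ?_)
  ring

include hd hβ in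
/-- Additivity of the Dirichlet form in the first argument. [folklore] -/
theorem dirichletForm_add_left {g₁ g₂ h : 𝔼 → ℝ} (hg₁ : FiniteEnergy β g₁) (hg₂ : FiniteEnergy β g₂)
    (hh : FiniteEnergy β h) :
    dirichletForm β (fun v => g₁ v + g₂ v) h = dirichletForm β g₁ h + dirichletForm β g₂ h := by
  have hc := carlemanForm_add_left hd hβ (h := h) hg₁.measurable hg₁.integrable hg₂.measurable hg₂.integrable
    hh.measurable hh.integrable
  rw [dirichletForm, dirichletForm, dirichletForm, show (fun v => g₁ v + g₂ v) = g₁ + g₂ from rfl, hc]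
  have e : (fun v => (g₁ v + g₂ v) * h v * (collisionFrequency β v * maxwellianBeta β v)) = fun v =>
      g₁ v * h v * (collisionFrequency β v * maxwellianBeta β v) +
        g₂ v * h v * (collisionFrequency β v * maxwellianBeta β v) := by
    funext v; ring
  rw [e, integral_add (hg₁.integrable_mul_mul hβ hh) (hg₂.integrable_mul_mul hβ hh)]
  ring

/-- Homogeneity of the Dirichlet form in the first argument. [folklore] -/
theorem dirichletForm_smul_left (c : ℝ) (g h : 𝔼 → ℝ) :
    dirichletForm β (fun v => c * g v) h = c * dirichletForm β g h := by
  have hc := carlemanForm_smul_left (β := β) c g h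
  rw [dirichletForm, dirichletForm, show (fun v => c * g v) = c • g from rfl, hc, mul_sub, ← integral_const_mul]
  congr 1
  refine integral_congr_ae (Eventually.of_forall fun v => ?_)
  show (c • g) v * h v * (collisionFrequency β v * maxwellianBeta β v) = _
  simp only [Pi.smul_apply, smul_eq_mul]
  ring

include hd hβ in
/-- Additivity of the Dirichlet form in the second argument. [folklore] -/
theorem dirichletForm_add_right {g h₁ h₂ : 𝔼 → ℝ} (hg : FiniteEnergy β g) (hh₁ : FiniteEnergy β h₁)
    (hh₂ : FiniteEnergy β h₂) :
    dirichletForm β g (fun v => h₁ v + h₂ v) = dirichletForm β g h₁ + dirichletForm β g h₂ := by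
  rw [dirichletForm_comm hβ, dirichletForm_add_left hd hβ hh₁ hh₂ hg, dirichletForm_comm hβ h₁,
    dirichletForm_comm hβ h₂]

include hβ in
/-- Homogeneity of the Dirichlet form in the second argument. [folklore] -/
theorem dirichletForm_smul_right (c : ℝ) (g h : 𝔼 → ℝ) :
    dirichletForm β g (fun v => c * h v) = c * dirichletForm β g h := by
  rw [dirichletForm_comm hβ, dirichletForm_smul_left, dirichletForm_comm hβ]

include hd hβ in
/-- Expansion of the quadratic form of a combination: `B(g + c h, g + c h) = B(g,g) + 2c B(g,h) + c² B(h,h)`.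
[folklore] -/
theorem dirichletForm_add_smul_self {g h : 𝔼 → ℝ} (hg : FiniteEnergy β g) (hh : FiniteEnergy β h) (c : ℝ) :
    dirichletForm β (fun v => g v + c * h v) (fun v => g v + c * h v) =
      dirichletForm β g g + 2 * c * dirichletForm β g h + c ^ 2 * dirichletForm β h h := by
  have hch := hh.const_mul' c
  rw [dirichletForm_add_left hd hβ hg hch (hg.add' hch hβ), dirichletForm_add_right hd hβ hg hg hch,
    dirichletForm_add_right hd hβ hch hg hch, dirichletForm_smul_right hβ, dirichletForm_smul_left,
    dirichletForm_smul_left, dirichletForm_smul_right hβ, dirichletForm_comm hβ h g]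
  ring

include hd hβ in
/-- **Absorption inequality for the Dirichlet form** (completing the square, `B ≥ 0`): for
`ε > 0`, `|B(g, h)| ≤ (ε B(g, g) + ε⁻¹ B(h, h)) / 2`. [folklore] -/
theorem abs_dirichletForm_le {g h : 𝔼 → ℝ} (hg : FiniteEnergy β g) (hh : FiniteEnergy β h) {ε : ℝ} (hε : 0 < ε) :
    |dirichletForm β g h| ≤ (ε * dirichletForm β g g + ε⁻¹ * dirichletForm β h h) / 2 := by
  have key : ∀ c : ℝ, 0 ≤ dirichletForm β h h + 2 * c * dirichletForm β h g + c ^ 2 * dirichletForm β g g := by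
    intro c
    rw [← dirichletForm_add_smul_self hd hβ hh hg c]
    exact dirichletForm_self_nonneg hd hβ (hh.add' (hg.const_mul' c) hβ)
  have hsymm : dirichletForm β h g = dirichletForm β g h := dirichletForm_comm hβ h g
  have h1 := key ε
  have h2 := key (-ε)
  rw [hsymm] at h1 h2
  have hrw : (ε * dirichletForm β g g + ε⁻¹ * dirichletForm β h h) / 2 =
      (ε ^ 2 * dirichletForm β g g + dirichletForm β h h) / (2 * ε) := by
    field_simp
  rw [abs_le, hrw]
  constructor
  · rw [neg_le, le_div_iff₀ (by positivity)]
    nlinarith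
  · rw [le_div_iff₀ (by positivity)]
    nlinarith

include hd hβ in
/-- `(K⁺ g) h M_β` is integrable for `g, h` of finite energy (a section of the integrable product
kernel of `carlemanForm_eq_integral_carlemanGain`). [folklore] -/
theorem integrable_carlemanGain_mul_mul {g h : 𝔼 → ℝ} (hg : FiniteEnergy β g) (hh : FiniteEnergy β h) :
    Integrable fun v => carlemanGain β g v * h v * maxwellianBeta β v := by
  have hP := (integrable_weight_mul_mul hd hβ hg.measurable hg.integrable hh.measurable hh.integrable).integral_prod_left
  refine hP.congr (Eventually.of_forall fun v => ?_)
  simp only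
  rw [carlemanGain, ← integral_mul_const, ← integral_mul_const]
  refine integral_congr_ae (Eventually.of_forall fun u => ?_)
  ring

include hd hβ in
/-- **The Dirichlet form through the operator**: `B(g, h) = ∫ (a_β g - K⁺_β g) h M_β` for `g, h` of
finite energy. [cite: BodineauGallagherSaintRaymondInvent2016, §6.1.2] -/
theorem dirichletForm_eq_integral {g h : 𝔼 → ℝ} (hg : FiniteEnergy β g) (hh : FiniteEnergy β h) :
    dirichletForm β g h =
      ∫ v, (collisionFrequency β v * g v - carlemanGain β g v) * h v * maxwellianBeta β v := by
  rw [dirichletForm, carlemanForm_eq_integral_carlemanGain hd hβ hg.measurable hg.integrable hh.measurable hh.integrable,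
    ← integral_sub (hg.integrable_mul_mul hβ hh) (integrable_carlemanGain_mul_mul hd hβ hg hh)]
  refine integral_congr_ae (Eventually.of_forall fun v => ?_)
  ring

end DirichletAlgebra

/-! ## The mode frequency, the mode corrector and the mode rate -/

section Mode

variable (hd : 2 ≤ Fintype.card d) (hβ : 0 < β)

/-- The *mode vector* `2π n ∈ ℝ^d` of the frequency `n ∈ ℤ^d`. [folklore] -/
def modeVec (n : d → ℤ) : 𝔼 := WithLp.toLp 2 fun i => 2 * Real.pi * (n i : ℝ)

omit [Fintype d] in
/-- Coordinates of the mode vector. [folklore] -/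
@[simp]
theorem modeVec_apply (n : d → ℤ) (i : d) : modeVec n i = 2 * Real.pi * (n i : ℝ) := rfl

/-- `|2π n|² = 4π² ∑ nᵢ²`. [folklore] -/
theorem norm_modeVec_sq (n : d → ℤ) : ‖(modeVec n : 𝔼)‖ ^ 2 = 4 * Real.pi ^ 2 * ∑ i, (n i : ℝ) ^ 2 := by
  rw [EuclideanSpace.norm_sq_eq, Finset.mul_sum]
  refine Finset.sum_congr rfl fun i _ => ?_
  rw [modeVec_apply, Real.norm_eq_abs, sq_abs]
  ring

/-- The *mode frequency* `ω(v) = 2π n·v` (the symbol of `v·∇ₓ` on the Fourier mode `e_n`).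
[cite: BodineauGallagherSaintRaymondInvent2016, (6.2)] -/
def modeFreq (n : d → ℤ) (v : 𝔼) : ℝ := ⟪(modeVec n : 𝔼), v⟫_ℝ

/-- The *mode corrector* `ω_b(v) = 2π n·b(v)`, with `b` the diffusion corrector of (6.5).
[cite: BodineauGallagherSaintRaymondInvent2016, (6.5)] -/
def modeCorrector (n : d → ℤ) (b : 𝔼 → 𝔼) (v : 𝔼) : ℝ := ⟪(modeVec n : 𝔼), b v⟫_ℝ

/-- The *mode rate* `λ = 4π² κ_β |n|²`, the heat multiplier exponent of the mode `n` (2.11).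
[cite: BodineauGallagherSaintRaymondInvent2016, (2.11) and (6.8)] -/
def modeRate (β : ℝ) (b : 𝔼 → 𝔼) (n : d → ℤ) : ℝ :=
  4 * Real.pi ^ 2 * bgsrDiffusionCoeff β b * ∑ i, (n i : ℝ) ^ 2

/-- `λ = κ_β |2π n|²`. [folklore] -/
theorem modeRate_eq (β : ℝ) (b : 𝔼 → 𝔼) (n : d → ℤ) :
    modeRate β b n = bgsrDiffusionCoeff β b * ‖(modeVec n : 𝔼)‖ ^ 2 := by
  rw [modeRate, norm_modeVec_sq]; ring

/-- `ω` in coordinates. [folklore] -/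
theorem modeFreq_eq_sum (n : d → ℤ) (v : 𝔼) : modeFreq n v = ∑ i, (2 * Real.pi * (n i : ℝ)) * v i := by
  rw [modeFreq, inner_eq_sum_apply]
  rfl

/-- `ω_b` in coordinates. [folklore] -/
theorem modeCorrector_eq_sum (n : d → ℤ) (b : 𝔼 → 𝔼) (v : 𝔼) :
    modeCorrector n b v = ∑ i, (2 * Real.pi * (n i : ℝ)) * b v i := by
  rw [modeCorrector, inner_eq_sum_apply]
  rfl

/-- `|ω(v)| ≤ |2π n| |v|`. [folklore] -/
theorem abs_modeFreq_le (n : d → ℤ) (v : 𝔼) : |modeFreq n v| ≤ ‖(modeVec n : 𝔼)‖ * ‖v‖ :=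
  abs_real_inner_le_norm _ _

/-- `ω` is continuous. [folklore] -/
theorem continuous_modeFreq (n : d → ℤ) : Continuous (modeFreq (d := d) n) :=
  continuous_const.inner continuous_id

include hβ in
/-- `ω` has finite energy. [folklore] -/
theorem finiteEnergy_modeFreq (n : d → ℤ) : FiniteEnergy β (modeFreq (d := d) n) := by
  have h := finiteEnergy_sum hβ Finset.univ (fun i => finiteEnergy_coord (d := d) hβ i) (fun i => 2 * Real.pi * (n i : ℝ))
  have e : modeFreq (d := d) n = fun v => ∑ i, (2 * Real.pi * (n i : ℝ)) * v i := funext (modeFreq_eq_sum n)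
  rw [e]
  exact h

include hβ in
/-- `ω_b` has finite energy. [folklore] -/
theorem finiteEnergy_modeCorrector (n : d → ℤ) {b : 𝔼 → 𝔼} (hb : IsDiffusionCorrector β b) :
    FiniteEnergy β (modeCorrector (d := d) n b) := by
  have h := finiteEnergy_sum hβ Finset.univ (fun i => hb.finiteEnergy_apply hβ i) (fun i => 2 * Real.pi * (n i : ℝ))
  have e : modeCorrector (d := d) n b = fun v => ∑ i, (2 * Real.pi * (n i : ℝ)) * b v i :=
    funext (modeCorrector_eq_sum n b)
  rw [e]
  exact h

include hd hβ in
/-- `ω_b` is centred: `∫ ω_b M_β = 0`. [folklore] -/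
theorem integral_modeCorrector_mul_maxwellianBeta (n : d → ℤ) {b : 𝔼 → 𝔼} (hb : IsDiffusionCorrector β b) :
    ∫ v, modeCorrector n b v * maxwellianBeta β v = 0 := by
  have hc : ∀ i, ∫ v, b v i * maxwellianBeta β v = 0 := fun i =>
    integral_apply_mul_maxwellianBeta_eq_zero hd hβ hb.1 (fun j => hb.finiteEnergy_apply hβ j) hb.2.2.1 i
  have hint : ∀ i, Integrable fun v => (2 * Real.pi * (n i : ℝ)) * (b v i * maxwellianBeta β v) := fun i =>
    (integrable_mul_maxwellianBeta_of_finiteEnergy hd hβ (hb.finiteEnergy_apply hβ i)).const_mul _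
  simp_rw [modeCorrector_eq_sum, Finset.sum_mul]
  rw [integral_finsetSum _ fun i _ => (hint i).congr (Eventually.of_forall fun v => by ring)]
  refine Finset.sum_eq_zero fun i _ => ?_
  rw [show (fun v => 2 * Real.pi * (n i : ℝ) * b v i * maxwellianBeta β v) =
    fun v => (2 * Real.pi * (n i : ℝ)) * (b v i * maxwellianBeta β v) by funext v; ring,
    integral_const_mul, hc i, mul_zero]

include hd hβ in
/-- **The mode corrector solves `L ω_b = ω`** (Carleman form, a.e.): `a_β ω_b - K⁺_β ω_b = ω`.
[cite: BodineauGallagherSaintRaymondInvent2016, (6.5)] -/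
theorem ae_sub_carlemanGain_modeCorrector (n : d → ℤ) {b : 𝔼 → 𝔼} (hb : IsDiffusionCorrector β b) :
    ∀ᵐ v : 𝔼, collisionFrequency β v * modeCorrector n b v - carlemanGain β (modeCorrector n b) v = modeFreq n v := by
  have hlin := sub_carlemanGain_sum_ae hd hβ Finset.univ (fun i => hb.finiteEnergy_apply hβ i)
    (fun i => 2 * Real.pi * (n i : ℝ))
  have heq := ae_all_iff.2 fun i => hb.ae_sub_carlemanGain_eq hd hβ i
  filter_upwards [hlin, heq] with v hv hi
  have e : modeCorrector n b = fun w => ∑ i, (2 * Real.pi * (n i : ℝ)) * b w i := funext (modeCorrector_eq_sum n b)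
  rw [e, hv, modeFreq_eq_sum]
  exact Finset.sum_congr rfl fun i _ => by rw [hi i]

include hd hβ in
/-- **`∫ ω ω_b M_β = λ`** (isotropy of the diffusion matrix, BGSR (6.8)).
[cite: BodineauGallagherSaintRaymondInvent2016, (6.8)] -/
theorem integral_modeFreq_mul_modeCorrector (n : d → ℤ) {b : 𝔼 → 𝔼} (hb : IsDiffusionCorrector β b) :
    ∫ v, modeFreq n v * modeCorrector n b v * maxwellianBeta β v = modeRate β b n := by
  rw [modeRate_eq]
  exact hb.integral_inner_mul_inner hd hβ (modeVec n)

include hd hβ in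
/-- **The second mode corrector** (BGSR (6.7) contracted with `2π n ⊗ 2π n`): there is `D_n` of
finite energy, centred, with `a_β D_n - K⁺_β D_n = ω ω_b - λ` a.e. — the combination
`∑_{k,l} (2π n_k)(2π n_l) D_{kl}` of the second correctors `L D_{kl} = v_k b_l - ∫ v_k b_l M_β`, using
`∑ (2π n_k)(2π n_l) ∫ v_k b_l M_β = λ`. [cite: BodineauGallagherSaintRaymondInvent2016, (6.7)–(6.8)] -/
theorem exists_secondModeCorrector (n : d → ℤ) {b : 𝔼 → 𝔼} (hb : IsDiffusionCorrector β b) :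
    ∃ D : 𝔼 → ℝ, FiniteEnergy β D ∧ ∫ v, D v * maxwellianBeta β v = 0 ∧
      ∀ᵐ v : 𝔼, collisionFrequency β v * D v - carlemanGain β D v =
        modeFreq n v * modeCorrector n b v - modeRate β b n := by
  classical
  choose D hD hDc hDL using fun p : d × d => exists_secondCorrector hd hβ hb p.1 p.2
  set c : d × d → ℝ := fun p => (2 * Real.pi * (n p.1 : ℝ)) * (2 * Real.pi * (n p.2 : ℝ)) with hc
  refine ⟨fun v => ∑ p ∈ Finset.univ, c p * D p v, finiteEnergy_sum hβ _ hD c, ?_, ?_⟩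
  · -- centring
    have hint : ∀ p, Integrable fun v => c p * (D p v * maxwellianBeta β v) := fun p =>
      (integrable_mul_maxwellianBeta_of_finiteEnergy hd hβ (hD p)).const_mul _
    simp_rw [Finset.sum_mul]
    rw [integral_finsetSum _ fun p _ => (hint p).congr (Eventually.of_forall fun v => by ring)]
    refine Finset.sum_eq_zero fun p _ => ?_
    rw [show (fun v => c p * D p v * maxwellianBeta β v) = fun v => c p * (D p v * maxwellianBeta β v) by
      funext v; ring, integral_const_mul, hDc p, mul_zero]
  · -- the equation
    have hlin := sub_carlemanGain_sum_ae hd hβ Finset.univ hD c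
    have hcarl : ∀ p, ∀ᵐ v : 𝔼, collisionFrequency β v * D p v - carlemanGain β (D p) v =
        v p.1 * b v p.2 - ∫ w : 𝔼, w p.1 * b w p.2 * maxwellianBeta β w := fun p => by
      filter_upwards [hDL p, ae_integrable_carlemanKernel_mul hd hβ (hD p).measurable (hD p).integrable] with v hv hint
      rw [← linearBoltzmannGain_eq_carlemanGain hd hβ (hD p).measurable v hint,
        ← linearBoltzmannOp_eq_sub hd hβ (hD p).measurable v hint]
      exact hv
    filter_upwards [hlin, ae_all_iff.2 hcarl] with v hv hp
    rw [hv, Finset.sum_congr rfl fun p _ => by rw [hp p]]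
    -- `∑ c_p (v_k b_l - K_kl) = ω ω_b - λ`
    simp only [mul_sub, Finset.sum_sub_distrib]
    congr 1
    · rw [modeFreq_eq_sum, modeCorrector_eq_sum, Finset.sum_mul_sum, ← Finset.univ_product_univ, Finset.sum_product]
      refine Finset.sum_congr rfl fun k _ => Finset.sum_congr rfl fun l _ => ?_
      simp only [hc]; ring
    · rw [modeRate]
      have hK : ∀ p : d × d, ∫ w : 𝔼, w p.1 * b w p.2 * maxwellianBeta β w =
          if p.1 = p.2 then bgsrDiffusionCoeff β b else 0 := fun p => by
        split_ifs with h
        · rw [h]; exact hb.integral_coord_mul_coord_self hd hβ p.2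
        · exact hb.integral_coord_mul_coord_of_ne hd hβ h
      simp_rw [hK, mul_ite, mul_zero]
      rw [← Finset.univ_product_univ, Finset.sum_product]
      simp only [Finset.sum_ite_eq, Finset.mem_univ, if_true, hc]
      rw [Finset.mul_sum]
      refine Finset.sum_congr rfl fun k _ => ?_
      ring

end Mode

/-! ## Bounded functions and the Carleman gain operator -/

section Bounded

variable (hd : 2 ≤ Fintype.card d) (hβ : 0 < β)

include hβ in
/-- A bounded measurable function has finite energy. [folklore] -/
theorem finiteEnergy_of_bounded {g : 𝔼 → ℝ} (hgm : Measurable g) {B : ℝ} (hB : ∀ v, |g v| ≤ B) :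
    FiniteEnergy β g := by
  refine ⟨hgm, ?_⟩
  refine ((integrable_collisionFrequency_mul_maxwellianBeta (d := d) hβ).const_mul (B ^ 2)).mono'
    (((hgm.pow_const 2).mul (continuous_collisionFrequency hβ).measurable).mul
      (measurable_maxwellianBeta β)).aestronglyMeasurable (Eventually.of_forall fun v => ?_)
  have ha := TaggedLinearBoltzmannSeries.collisionFrequency_nonneg hβ v
  have hM := (maxwellianBeta_pos hβ v).le
  rw [Real.norm_of_nonneg (mul_nonneg (mul_nonneg (sq_nonneg _) ha) hM)]
  have h2 : g v ^ 2 ≤ B ^ 2 := by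
    have := hB v
    rw [← sq_abs]; exact pow_le_pow_left₀ (abs_nonneg _) this 2
  calc g v ^ 2 * collisionFrequency β v * maxwellianBeta β v
      ≤ B ^ 2 * collisionFrequency β v * maxwellianBeta β v := by gcongr
    _ = B ^ 2 * (collisionFrequency β v * maxwellianBeta β v) := by ring

include hd hβ in
/-- The Carleman integrand of a bounded measurable function converges at every `v`. [folklore] -/
theorem integrable_carlemanKernel_mul_of_bounded {g : 𝔼 → ℝ} (hgm : Measurable g) {B : ℝ}
    (hB : ∀ v, |g v| ≤ B) (v : 𝔼) :
    Integrable fun u => carlemanKernel β v u * g (v + u) := by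
  refine ((integrable_carlemanKernel hd hβ v).mul_const B).mono'
    ((measurable_carlemanKernel_right β v).mul (hgm.comp (measurable_const_add v))).aestronglyMeasurable
    (Eventually.of_forall fun u => ?_)
  rw [Real.norm_eq_abs, abs_mul, abs_of_nonneg (carlemanKernel_nonneg β v u)]
  exact mul_le_mul_of_nonneg_left (hB _) (carlemanKernel_nonneg β v u)

include hd hβ in
/-- `|K⁺ g| ≤ B a_β` for `|g| ≤ B`. [folklore] -/
theorem abs_carlemanGain_le_of_bounded {g : 𝔼 → ℝ} {B : ℝ} (hB : ∀ v, |g v| ≤ B) (v : 𝔼) :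
    |carlemanGain β g v| ≤ B * collisionFrequency β v := by
  rw [carlemanGain, ← integral_carlemanKernel hd hβ v, ← integral_const_mul]
  refine (abs_integral_le_integral_abs).trans ?_
  refine integral_mono_of_nonneg (Eventually.of_forall fun u => abs_nonneg _)
    ((integrable_carlemanKernel hd hβ v).const_mul B) (Eventually.of_forall fun u => ?_)
  show |carlemanKernel β v u * g (v + u)| ≤ B * carlemanKernel β v u
  rw [abs_mul, abs_of_nonneg (carlemanKernel_nonneg β v u), mul_comm B]
  exact mul_le_mul_of_nonneg_left (hB _) (carlemanKernel_nonneg β v u)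

include hd hβ in
/-- `K⁺(g + c) = K⁺ g + c a_β` for bounded measurable `g`. [folklore] -/
theorem carlemanGain_add_const_of_bounded {g : 𝔼 → ℝ} (hgm : Measurable g) {B : ℝ}
    (hB : ∀ v, |g v| ≤ B) (c : ℝ) (v : 𝔼) :
    carlemanGain β (fun w => g w + c) v = carlemanGain β g v + c * collisionFrequency β v := by
  rw [← carlemanGain_const hd hβ c v]
  exact carlemanGain_add_of_integrable β v (integrable_carlemanKernel_mul_of_bounded hd hβ hgm hB v)
    ((integrable_carlemanKernel hd hβ v).mul_const c)

end Bounded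

/-! ## The energy identity on one mode (real form)

We write the mode amplitude as `G = P + i Q` and the approximate solution as
`Ψ = e^{-λτ}(1 - i α⁻¹ ω_b)`, so that with `E = e^{-λτ}` the deviation `R = G - Ψ` has components
`p = P - E`, `q = Q + E ω_b / α`. The velocity-only equation `∂_τ G = -(α² a + i α ω) G + α² K⁺ G`
reads `∂P = -α² a P + α ω Q + α² K⁺P`, `∂Q = -α² a Q - α ω P + α² K⁺ Q`. -/



/-! ## Solutions of the mode equation and the deviation from the Hilbert expansion -/

section ModePair

variable (hd : 2 ≤ Fintype.card d) (hβ : 0 < β)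

/-- *Hypothesis bundle (not a vendored fact):* `(P, Q)` are the real and imaginary parts of a
solution `G = P + iQ` of the rescaled mode equation `∂_τ G = -(α² a_β + i α ω) G + α² K⁺_β G`,
`G(0) = 1`, bounded by `1`, measurable in `v`, continuous in `τ`, and differentiable in `τ > 0`
pointwise in `v` (what the collision series delivers for the mode amplitude `ĝ_n(ατ, v)`).
[cite: BodineauGallagherSaintRaymondInvent2016, (6.2)] -/
structure IsModePair (β α : ℝ) (n : d → ℤ) (P Q : ℝ → 𝔼 → ℝ) : Prop where
  /-- measurability in `v` -/
  fst_measurable : ∀ τ, Measurable (P τ)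
  /-- measurability in `v` -/
  snd_measurable : ∀ τ, Measurable (Q τ)
  /-- `|P| ≤ 1` -/
  abs_fst_le : ∀ τ v, |P τ v| ≤ 1
  /-- `|Q| ≤ 1` -/
  abs_snd_le : ∀ τ v, |Q τ v| ≤ 1
  /-- `P(0) = 1` -/
  fst_zero : ∀ v, P 0 v = 1
  /-- `Q(0) = 0` -/
  snd_zero : ∀ v, Q 0 v = 0
  /-- continuity in `τ` -/
  fst_continuous : ∀ v, Continuous fun τ => P τ v
  /-- continuity in `τ` -/
  snd_continuous : ∀ v, Continuous fun τ => Q τ v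
  /-- the real part of the mode equation -/
  fst_hasDerivAt : ∀ v τ, 0 < τ → HasDerivAt (fun σ => P σ v)
    (-(α ^ 2 * collisionFrequency β v) * P τ v + α * modeFreq n v * Q τ v +
      α ^ 2 * carlemanGain β (P τ) v) τ
  /-- the imaginary part of the mode equation -/
  snd_hasDerivAt : ∀ v τ, 0 < τ → HasDerivAt (fun σ => Q σ v)
    (-(α ^ 2 * collisionFrequency β v) * Q τ v - α * modeFreq n v * P τ v +
      α ^ 2 * carlemanGain β (Q τ) v) τ

/-- The heat multiplier `E(τ) = e^{-λτ}` of the mode. [folklore] -/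
def modeMult (β : ℝ) (b : 𝔼 → 𝔼) (n : d → ℤ) (τ : ℝ) : ℝ := Real.exp (-(modeRate β b n * τ))

/-- First deviation component `p = P - E`. [folklore] -/
def devFst (β : ℝ) (b : 𝔼 → 𝔼) (n : d → ℤ) (P : ℝ → 𝔼 → ℝ) (τ : ℝ) (v : 𝔼) : ℝ :=
  P τ v - modeMult β b n τ

/-- Second deviation component `q = Q + E ω_b / α`. [folklore] -/
def devSnd (β : ℝ) (b : 𝔼 → 𝔼) (n : d → ℤ) (α : ℝ) (Q : ℝ → 𝔼 → ℝ) (τ : ℝ) (v : 𝔼) : ℝ :=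
  Q τ v + modeMult β b n τ * modeCorrector n b v / α

/-- The **mode energy** `y(τ) = ∫ (p² + q²) M_β = ‖G(τ) - Ψ(τ)‖²_{L²(M_β)}`, the squared
`L²(M_β)`-distance of the solution from the two-term Hilbert expansion
`Ψ = e^{-λτ}(1 - i α⁻¹ ω_b)`. [cite: BodineauGallagherSaintRaymondInvent2016, (6.9)] -/
def modeEnergy (β : ℝ) (b : 𝔼 → 𝔼) (n : d → ℤ) (α : ℝ) (P Q : ℝ → 𝔼 → ℝ) (τ : ℝ) : ℝ :=
  ∫ v, (devFst β b n P τ v ^ 2 + devSnd β b n α Q τ v ^ 2) * maxwellianBeta β v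

/-- `E > 0`. [folklore] -/
theorem modeMult_pos (β : ℝ) (b : 𝔼 → 𝔼) (n : d → ℤ) (τ : ℝ) : 0 < modeMult β b n τ := Real.exp_pos _

/-- `E' = -λ E`. [folklore] -/
theorem hasDerivAt_modeMult (β : ℝ) (b : 𝔼 → 𝔼) (n : d → ℤ) (τ : ℝ) :
    HasDerivAt (modeMult β b n) (-(modeRate β b n) * modeMult β b n τ) τ := by
  have h1 : HasDerivAt (fun σ : ℝ => σ * -(modeRate β b n)) (-(modeRate β b n)) τ := hasDerivAt_mul_const _
  have h2 : HasDerivAt (fun σ : ℝ => Real.exp (σ * -(modeRate β b n)))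
      (Real.exp (τ * -(modeRate β b n)) * -(modeRate β b n)) τ := h1.exp
  have e : modeMult β b n = fun σ : ℝ => Real.exp (σ * -(modeRate β b n)) := by
    funext σ; simp only [modeMult]; ring_nf
  rw [e]
  convert h2 using 1
  simp only
  ring

/-- `g h M_β` is integrable for `g, h` of finite energy. [folklore] -/
theorem FiniteEnergy.integrable_mul_mul_maxwellianBeta {g h : 𝔼 → ℝ} (hg : FiniteEnergy β g) (hh : FiniteEnergy β h)
    (hd : 2 ≤ Fintype.card d) (hβ : 0 < β) :
    Integrable fun v => g v * h v * maxwellianBeta β v := by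
  refine (((integrable_sq_mul_maxwellianBeta_of_finiteEnergy hd hβ hg).add
    (integrable_sq_mul_maxwellianBeta_of_finiteEnergy hd hβ hh)).div_const 2).mono'
    (((hg.measurable.mul hh.measurable).mul (measurable_maxwellianBeta β)).aestronglyMeasurable)
    (Eventually.of_forall fun v => ?_)
  have hM := (maxwellianBeta_pos hβ v).le
  rw [Real.norm_eq_abs, abs_mul, abs_of_nonneg hM, abs_mul]
  simp only [Pi.add_apply]
  rw [le_div_iff₀ two_pos]
  nlinarith [mul_nonneg (mul_self_nonneg (|g v| - |h v|)) hM, sq_abs (g v), sq_abs (h v)]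

namespace IsModePair

/-- The derivative of the first deviation component: `∂p = ∂P + λ E`. [folklore] -/
theorem hasDerivAt_devFst {b : 𝔼 → 𝔼} {n : d → ℤ} {α : ℝ} {P Q : ℝ → 𝔼 → ℝ}
    (h : IsModePair β α n P Q) (v : 𝔼) {τ : ℝ} (hτ : 0 < τ) :
    HasDerivAt (fun σ => devFst β b n P σ v)
      (-(α ^ 2 * collisionFrequency β v) * P τ v + α * modeFreq n v * Q τ v +
        α ^ 2 * carlemanGain β (P τ) v + modeRate β b n * modeMult β b n τ) τ := by
  unfold devFst
  exact ((h.fst_hasDerivAt v τ hτ).sub (hasDerivAt_modeMult β b n τ)).congr_deriv (by ring)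

/-- The derivative of the second deviation component: `∂q = ∂Q - λ E ω_b / α`. [folklore] -/
theorem hasDerivAt_devSnd {b : 𝔼 → 𝔼} {n : d → ℤ} {α : ℝ} {P Q : ℝ → 𝔼 → ℝ}
    (h : IsModePair β α n P Q) (v : 𝔼) {τ : ℝ} (hτ : 0 < τ) :
    HasDerivAt (fun σ => devSnd β b n α Q σ v)
      (-(α ^ 2 * collisionFrequency β v) * Q τ v - α * modeFreq n v * P τ v +
        α ^ 2 * carlemanGain β (Q τ) v - modeRate β b n * modeMult β b n τ * modeCorrector n b v / α) τ := by
  unfold devSnd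
  have h2 := ((hasDerivAt_modeMult β b n τ).mul_const (modeCorrector n b v)).div_const α
  exact ((h.snd_hasDerivAt v τ hτ).add h2).congr_deriv (by ring)

/-- `|p| ≤ 1 + E`. [folklore] -/
theorem abs_devFst_le {b : 𝔼 → 𝔼} {n : d → ℤ} {α : ℝ} {P Q : ℝ → 𝔼 → ℝ}
    (h : IsModePair β α n P Q) (τ : ℝ) (v : 𝔼) :
    |devFst β b n P τ v| ≤ 1 + modeMult β b n τ := by
  unfold devFst
  have := h.abs_fst_le τ v
  have hE := (modeMult_pos β b n τ).le
  rw [abs_le] at this ⊢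
  constructor <;> linarith [this.1, this.2]

/-- `|q| ≤ 1 + E |ω_b| / α`. [folklore] -/
theorem abs_devSnd_le {b : 𝔼 → 𝔼} {n : d → ℤ} {α : ℝ} {P Q : ℝ → 𝔼 → ℝ}
    (h : IsModePair β α n P Q) (hα : 0 < α) (τ : ℝ) (v : 𝔼) :
    |devSnd β b n α Q τ v| ≤ 1 + modeMult β b n τ * |modeCorrector n b v| / α := by
  unfold devSnd
  refine (abs_add_le _ _).trans (add_le_add (h.abs_snd_le τ v) (le_of_eq ?_))
  rw [abs_div, abs_mul, abs_of_pos (modeMult_pos β b n τ), abs_of_pos hα]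

/-- `p(τ, ·)` is bounded measurable, hence of finite energy. [folklore] -/
theorem finiteEnergy_devFst {b : 𝔼 → 𝔼} {n : d → ℤ} {α : ℝ} {P Q : ℝ → 𝔼 → ℝ}
    (h : IsModePair β α n P Q) (hβ : 0 < β) (τ : ℝ) :
    FiniteEnergy β (devFst β b n P τ) :=
  finiteEnergy_of_bounded hβ ((h.fst_measurable τ).sub measurable_const) (h.abs_devFst_le (b := b) τ)

/-- `q(τ, ·)` has finite energy. [folklore] -/
theorem finiteEnergy_devSnd {b : 𝔼 → 𝔼} {n : d → ℤ} {α : ℝ} {P Q : ℝ → 𝔼 → ℝ}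
    (h : IsModePair β α n P Q) (hβ : 0 < β) (hb : IsDiffusionCorrector β b) (τ : ℝ) :
    FiniteEnergy β (devSnd β b n α Q τ) := by
  have h1 : FiniteEnergy β (Q τ) := finiteEnergy_of_bounded hβ (h.snd_measurable τ) (h.abs_snd_le τ)
  have h2 := (finiteEnergy_modeCorrector hβ n hb).const_mul' (modeMult β b n τ / α)
  have e : devSnd β b n α Q τ = fun v => Q τ v + modeMult β b n τ / α * modeCorrector n b v := by
    funext v; simp only [devSnd]; ring
  rw [e]
  exact h1.add' h2 hβ

/-- `K⁺p = K⁺P - E a_β` (everywhere). [folklore] -/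
theorem carlemanGain_devFst {b : 𝔼 → 𝔼} {n : d → ℤ} {α : ℝ} {P Q : ℝ → 𝔼 → ℝ}
    (h : IsModePair β α n P Q) (hd : 2 ≤ Fintype.card d) (hβ : 0 < β)
    (τ : ℝ) (v : 𝔼) :
    carlemanGain β (devFst β b n P τ) v =
      carlemanGain β (P τ) v - modeMult β b n τ * collisionFrequency β v := by
  have e : devFst β b n P τ = fun w => P τ w + -(modeMult β b n τ) := by
    funext w; simp only [devFst]; ring
  rw [e, carlemanGain_add_const_of_bounded hd hβ (h.fst_measurable τ) (h.abs_fst_le τ)]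
  ring

/-- `K⁺q = K⁺Q + (E/α) K⁺ω_b` where the Carleman integral of `ω_b` converges. [folklore] -/
theorem carlemanGain_devSnd {b : 𝔼 → 𝔼} {n : d → ℤ} {α : ℝ} {P Q : ℝ → 𝔼 → ℝ}
    (h : IsModePair β α n P Q) (hd : 2 ≤ Fintype.card d) (hβ : 0 < β)
    (τ : ℝ) {v : 𝔼}
    (hint : Integrable fun u => carlemanKernel β v u * modeCorrector n b (v + u)) :
    carlemanGain β (devSnd β b n α Q τ) v =
      carlemanGain β (Q τ) v + modeMult β b n τ / α * carlemanGain β (modeCorrector n b) v := by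
  have e : devSnd β b n α Q τ = fun w => Q τ w + modeMult β b n τ / α * modeCorrector n b w := by
    funext w; simp only [devSnd]; ring
  rw [e, carlemanGain_add_of_integrable β v
    (integrable_carlemanKernel_mul_of_bounded hd hβ (h.snd_measurable τ) (h.abs_snd_le τ) v)
    ((hint.const_mul (modeMult β b n τ / α)).congr (Eventually.of_forall fun u => by ring)),
    carlemanGain_const_mul]

/-- **The pointwise energy identity of the Hilbert expansion** (a.e. in `v`, for all `τ`): with
`∂p = ∂P + λE`, `∂q = ∂Q - λEω_b/α`,
`p ∂p + q ∂q = -α² (p (a p - K⁺p) + q (a q - K⁺q)) - E p (a D - K⁺D) - (λE/α) q ω_b`;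
the transport terms `αω(Qp - Pq)` are exactly cancelled by the corrector identities
`a ω_b - K⁺ω_b = ω` (6.5) and `a D - K⁺D = ω ω_b - λ` (6.7)–(6.8).
[cite: BodineauGallagherSaintRaymondInvent2016, §6.1.2–6.1.3] -/
theorem ae_energy_identity {b : 𝔼 → 𝔼} {n : d → ℤ} {α : ℝ} {P Q : ℝ → 𝔼 → ℝ}
    (h : IsModePair β α n P Q) (hd : 2 ≤ Fintype.card d) (hβ : 0 < β)
    (hb : IsDiffusionCorrector β b) (hα : 0 < α) {D : 𝔼 → ℝ}
    (hDeq : ∀ᵐ v : 𝔼, collisionFrequency β v * D v - carlemanGain β D v =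
      modeFreq n v * modeCorrector n b v - modeRate β b n) :
    ∀ᵐ v : 𝔼, ∀ τ : ℝ,
      devFst β b n P τ v * (-(α ^ 2 * collisionFrequency β v) * P τ v + α * modeFreq n v * Q τ v +
          α ^ 2 * carlemanGain β (P τ) v + modeRate β b n * modeMult β b n τ) +
        devSnd β b n α Q τ v * (-(α ^ 2 * collisionFrequency β v) * Q τ v - α * modeFreq n v * P τ v +
          α ^ 2 * carlemanGain β (Q τ) v - modeRate β b n * modeMult β b n τ * modeCorrector n b v / α) =
      -α ^ 2 * (devFst β b n P τ v * (collisionFrequency β v * devFst β b n P τ v - carlemanGain β (devFst β b n P τ) v) +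
          devSnd β b n α Q τ v * (collisionFrequency β v * devSnd β b n α Q τ v - carlemanGain β (devSnd β b n α Q τ) v)) -
        modeMult β b n τ * devFst β b n P τ v * (collisionFrequency β v * D v - carlemanGain β D v) -
        modeRate β b n * modeMult β b n τ / α * devSnd β b n α Q τ v * modeCorrector n b v := by
  have hwb := finiteEnergy_modeCorrector hβ n hb
  filter_upwards [ae_integrable_carlemanKernel_mul hd hβ hwb.measurable hwb.integrable,
    ae_sub_carlemanGain_modeCorrector hd hβ n hb, hDeq] with v hint hcorr hD
  intro τ
  rw [h.carlemanGain_devFst hd hβ τ v, h.carlemanGain_devSnd hd hβ τ hint]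
  have hkwb : carlemanGain β (modeCorrector n b) v =
      collisionFrequency β v * modeCorrector n b v - modeFreq n v := by linarith
  have hkD : carlemanGain β D v =
      collisionFrequency β v * D v - (modeFreq n v * modeCorrector n b v - modeRate β b n) := by linarith
  rw [hkwb, hkD]
  simp only [devFst, devSnd]
  field_simp
  ring

/-- `(a_β g - K⁺ g) h M_β` is integrable for `g, h` of finite energy. [folklore] -/
theorem integrable_opMul (hd : 2 ≤ Fintype.card d) (hβ : 0 < β) {g k : 𝔼 → ℝ}
    (hg : FiniteEnergy β g) (hk : FiniteEnergy β k) :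
    Integrable fun v => (collisionFrequency β v * g v - carlemanGain β g v) * k v * maxwellianBeta β v := by
  refine ((hg.integrable_mul_mul hβ hk).sub (integrable_carlemanGain_mul_mul hd hβ hg hk)).congr
    (Eventually.of_forall fun v => ?_)
  simp only [Pi.sub_apply]
  ring

/-- **The integrated energy identity**: for every `τ`,
`∫ (p ∂p + q ∂q) M_β = -α² (B(p,p) + B(q,q)) - E B(D, p) - (λE/α) ∫ q ω_b M_β`.
[cite: BodineauGallagherSaintRaymondInvent2016, §6.1.3] -/
theorem integral_energy_identity {b : 𝔼 → 𝔼} {n : d → ℤ} {α : ℝ} {P Q : ℝ → 𝔼 → ℝ}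
    (h : IsModePair β α n P Q) (hd : 2 ≤ Fintype.card d) (hβ : 0 < β)
    (hb : IsDiffusionCorrector β b) (hα : 0 < α) {D : 𝔼 → ℝ} (hD : FiniteEnergy β D)
    (hDeq : ∀ᵐ v : 𝔼, collisionFrequency β v * D v - carlemanGain β D v =
      modeFreq n v * modeCorrector n b v - modeRate β b n) (τ : ℝ) :
    ∫ v, (devFst β b n P τ v * (-(α ^ 2 * collisionFrequency β v) * P τ v + α * modeFreq n v * Q τ v +
          α ^ 2 * carlemanGain β (P τ) v + modeRate β b n * modeMult β b n τ) +
        devSnd β b n α Q τ v * (-(α ^ 2 * collisionFrequency β v) * Q τ v - α * modeFreq n v * P τ v +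
          α ^ 2 * carlemanGain β (Q τ) v - modeRate β b n * modeMult β b n τ * modeCorrector n b v / α)) *
        maxwellianBeta β v =
      -α ^ 2 * (dirichletForm β (devFst β b n P τ) (devFst β b n P τ) +
          dirichletForm β (devSnd β b n α Q τ) (devSnd β b n α Q τ)) -
        modeMult β b n τ * dirichletForm β D (devFst β b n P τ) -
        modeRate β b n * modeMult β b n τ / α * ∫ v, devSnd β b n α Q τ v * modeCorrector n b v * maxwellianBeta β v := by
  have hp := h.finiteEnergy_devFst (b := b) hβ τ
  have hq := h.finiteEnergy_devSnd hβ hb τ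
  have hwb := finiteEnergy_modeCorrector hβ n hb
  have hae := h.ae_energy_identity hd hβ hb hα hDeq
  -- replace the integrand a.e.
  have step1 : ∫ v, (devFst β b n P τ v * (-(α ^ 2 * collisionFrequency β v) * P τ v + α * modeFreq n v * Q τ v +
          α ^ 2 * carlemanGain β (P τ) v + modeRate β b n * modeMult β b n τ) +
        devSnd β b n α Q τ v * (-(α ^ 2 * collisionFrequency β v) * Q τ v - α * modeFreq n v * P τ v +
          α ^ 2 * carlemanGain β (Q τ) v - modeRate β b n * modeMult β b n τ * modeCorrector n b v / α)) *
        maxwellianBeta β v =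
      ∫ v, ((-α ^ 2) * ((collisionFrequency β v * devFst β b n P τ v - carlemanGain β (devFst β b n P τ) v) *
            devFst β b n P τ v * maxwellianBeta β v +
          (collisionFrequency β v * devSnd β b n α Q τ v - carlemanGain β (devSnd β b n α Q τ) v) *
            devSnd β b n α Q τ v * maxwellianBeta β v) +
        (-(modeMult β b n τ)) * ((collisionFrequency β v * D v - carlemanGain β D v) * devFst β b n P τ v *
            maxwellianBeta β v) +
        (-(modeRate β b n * modeMult β b n τ / α)) * (devSnd β b n α Q τ v * modeCorrector n b v *
            maxwellianBeta β v)) := by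
    refine integral_congr_ae ?_
    filter_upwards [hae] with v hv
    rw [hv τ]
    ring
  rw [step1, integral_add, integral_add, integral_const_mul, integral_const_mul, integral_const_mul,
    integral_add (integrable_opMul hd hβ hp hp) (integrable_opMul hd hβ hq hq),
    ← dirichletForm_eq_integral hd hβ hp hp, ← dirichletForm_eq_integral hd hβ hq hq,
    ← dirichletForm_eq_integral hd hβ hD hp]
  · ring
  · exact ((integrable_opMul hd hβ hp hp).add (integrable_opMul hd hβ hq hq)).const_mul _
  · exact (integrable_opMul hd hβ hD hp).const_mul _
  · exact (((integrable_opMul hd hβ hp hp).add (integrable_opMul hd hβ hq hq)).const_mul _).add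
      ((integrable_opMul hd hβ hD hp).const_mul _)
  · exact (hq.integrable_mul_mul_maxwellianBeta hwb hd hβ).const_mul _

/-! ### Measurability and bounds for the derivative of the energy density -/

/-- `E ≤ 1` for `τ ≥ 0` when `λ ≥ 0`. [folklore] -/
theorem modeMult_le_one {b : 𝔼 → 𝔼} {n : d → ℤ} (hlam : 0 ≤ modeRate β b n) {τ : ℝ} (hτ : 0 ≤ τ) :
    modeMult β b n τ ≤ 1 := by
  unfold modeMult
  rw [Real.exp_le_one_iff, neg_nonpos]
  exact mul_nonneg hlam hτ

/-- `λ ≥ 0` (indeed `κ_β > 0`). [folklore] -/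
theorem modeRate_nonneg (hd : 2 ≤ Fintype.card d) (hβ : 0 < β) {b : 𝔼 → 𝔼} (hb : IsDiffusionCorrector β b)
    (n : d → ℤ) : 0 ≤ modeRate β b n := by
  unfold modeRate
  have := bgsr_diffusionCoeff_pos_holds hd hβ b hb
  positivity

/-- `v ↦ K⁺ g (v)` is measurable for measurable `g`. [folklore] -/
theorem measurable_carlemanGain {g : 𝔼 → ℝ} (hg : Measurable g) : Measurable (carlemanGain β g) := by
  have hf : Measurable fun z : 𝔼 × 𝔼 => carlemanKernel β z.1 z.2 * g (z.1 + z.2) :=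
    (measurable_carlemanKernel β).mul (hg.comp (measurable_fst.add measurable_snd))
  exact (hf.stronglyMeasurable.integral_prod_right' (ν := volume)).measurable

/-- The derivative `∂p` as a function. [folklore] -/
def derivFst (β : ℝ) (b : 𝔼 → 𝔼) (n : d → ℤ) (α : ℝ) (P Q : ℝ → 𝔼 → ℝ) (τ : ℝ) (v : 𝔼) : ℝ :=
  -(α ^ 2 * collisionFrequency β v) * P τ v + α * modeFreq n v * Q τ v +
    α ^ 2 * carlemanGain β (P τ) v + modeRate β b n * modeMult β b n τ

/-- The derivative `∂q` as a function. [folklore] -/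
def derivSnd (β : ℝ) (b : 𝔼 → 𝔼) (n : d → ℤ) (α : ℝ) (P Q : ℝ → 𝔼 → ℝ) (τ : ℝ) (v : 𝔼) : ℝ :=
  -(α ^ 2 * collisionFrequency β v) * Q τ v - α * modeFreq n v * P τ v +
    α ^ 2 * carlemanGain β (Q τ) v - modeRate β b n * modeMult β b n τ * modeCorrector n b v / α

/-- The energy density `(p² + q²) M_β`. [folklore] -/
def energyDensity (β : ℝ) (b : 𝔼 → 𝔼) (n : d → ℤ) (α : ℝ) (P Q : ℝ → 𝔼 → ℝ) (τ : ℝ) (v : 𝔼) : ℝ :=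
  (devFst β b n P τ v ^ 2 + devSnd β b n α Q τ v ^ 2) * maxwellianBeta β v

/-- Its `τ`-derivative `2 (p ∂p + q ∂q) M_β`. [folklore] -/
def energyDensityDeriv (β : ℝ) (b : 𝔼 → 𝔼) (n : d → ℤ) (α : ℝ) (P Q : ℝ → 𝔼 → ℝ) (τ : ℝ) (v : 𝔼) : ℝ :=
  2 * (devFst β b n P τ v * derivFst β b n α P Q τ v + devSnd β b n α Q τ v * derivSnd β b n α P Q τ v) *
    maxwellianBeta β v

/-- The energy is the integral of the energy density. [folklore] -/
theorem modeEnergy_eq (β : ℝ) (b : 𝔼 → 𝔼) (n : d → ℤ) (α : ℝ) (P Q : ℝ → 𝔼 → ℝ) (τ : ℝ) :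
    modeEnergy β b n α P Q τ = ∫ v, energyDensity β b n α P Q τ v := rfl

/-- **Pointwise differentiability of the energy density** in `τ > 0`. [folklore] -/
theorem hasDerivAt_energyDensity {b : 𝔼 → 𝔼} {n : d → ℤ} {α : ℝ} {P Q : ℝ → 𝔼 → ℝ}
    (h : IsModePair β α n P Q) (v : 𝔼) {τ : ℝ} (hτ : 0 < τ) :
    HasDerivAt (fun σ => energyDensity β b n α P Q σ v) (energyDensityDeriv β b n α P Q τ v) τ := by
  have h1 := h.hasDerivAt_devFst (b := b) v hτ
  have h2 := h.hasDerivAt_devSnd (b := b) v hτ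
  have h3 := ((h1.pow 2).add (h2.pow 2)).mul_const (maxwellianBeta β v)
  unfold energyDensity energyDensityDeriv derivFst derivSnd
  refine h3.congr_deriv ?_
  simp only [Nat.cast_ofNat]
  ring

/-- Measurability of the energy density in `v`. [folklore] -/
theorem measurable_energyDensity {b : 𝔼 → 𝔼} {n : d → ℤ} {α : ℝ} {P Q : ℝ → 𝔼 → ℝ}
    (h : IsModePair β α n P Q) (hβ : 0 < β) (hb : IsDiffusionCorrector β b) (τ : ℝ) :
    Measurable (energyDensity β b n α P Q τ) := by
  unfold energyDensity
  exact (((h.finiteEnergy_devFst (b := b) hβ τ).measurable.pow_const 2).add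
    ((h.finiteEnergy_devSnd hβ hb τ).measurable.pow_const 2)).mul (measurable_maxwellianBeta β)

/-- Measurability of `∂p` in `v`. [folklore] -/
theorem measurable_derivFst {b : 𝔼 → 𝔼} {n : d → ℤ} {α : ℝ} {P Q : ℝ → 𝔼 → ℝ}
    (h : IsModePair β α n P Q) (hβ : 0 < β) (τ : ℝ) : Measurable (derivFst β b n α P Q τ) := by
  unfold derivFst
  have ha := (continuous_collisionFrequency (d := d) hβ).measurable
  have hω := (continuous_modeFreq (d := d) n).measurable
  exact ((((measurable_const.mul ha).neg.mul (h.fst_measurable τ)).add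
    ((measurable_const.mul hω).mul (h.snd_measurable τ))).add
    (measurable_const.mul (measurable_carlemanGain (h.fst_measurable τ)))).add measurable_const

/-- Measurability of `∂q` in `v`. [folklore] -/
theorem measurable_derivSnd {b : 𝔼 → 𝔼} {n : d → ℤ} {α : ℝ} {P Q : ℝ → 𝔼 → ℝ}
    (h : IsModePair β α n P Q) (hβ : 0 < β) (hb : IsDiffusionCorrector β b) (τ : ℝ) :
    Measurable (derivSnd β b n α P Q τ) := by
  unfold derivSnd
  have ha := (continuous_collisionFrequency (d := d) hβ).measurable
  have hω := (continuous_modeFreq (d := d) n).measurable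
  have hwb := (finiteEnergy_modeCorrector hβ n hb).measurable
  exact ((((measurable_const.mul ha).neg.mul (h.snd_measurable τ)).sub
    ((measurable_const.mul hω).mul (h.fst_measurable τ))).add
    (measurable_const.mul (measurable_carlemanGain (h.snd_measurable τ)))).sub
    (((measurable_const.mul hwb)).div_const α)

/-- Measurability of the derivative of the energy density in `v`. [folklore] -/
theorem measurable_energyDensityDeriv {b : 𝔼 → 𝔼} {n : d → ℤ} {α : ℝ} {P Q : ℝ → 𝔼 → ℝ}
    (h : IsModePair β α n P Q) (hβ : 0 < β) (hb : IsDiffusionCorrector β b) (τ : ℝ) :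
    Measurable (energyDensityDeriv β b n α P Q τ) := by
  unfold energyDensityDeriv
  exact (measurable_const.mul (((h.finiteEnergy_devFst (b := b) hβ τ).measurable.mul
    (h.measurable_derivFst (b := b) hβ τ)).add ((h.finiteEnergy_devSnd hβ hb τ).measurable.mul
    (h.measurable_derivSnd hβ hb τ)))).mul (measurable_maxwellianBeta β)

/-! ### Uniform bounds on the derivative of the energy density -/

/-- **Bounds on `∂p`, `∂q`, the density and its derivative** for `τ ≥ 0`, `α ≥ 1`: with
`A = 2α² + α C_ω + λ/a₀` (`|ω| ≤ C_ω a_β`, `a_β ≥ a₀`), `|∂p| ≤ A a_β`, `|∂q| ≤ A a_β (1 + |ω_b|)`,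
`|p| ≤ 2`, `|q| ≤ 1 + |ω_b|`, hence `|(p² + q²) M_β| ≤ (6 + 2ω_b²) M_β` and
`|2(p ∂p + q ∂q) M_β| ≤ 4A (2 + ω_b²) a_β M_β`. [folklore] -/
theorem exists_bounds (hd : 2 ≤ Fintype.card d) (hβ : 0 < β) {b : 𝔼 → 𝔼} (hb : IsDiffusionCorrector β b)
    (n : d → ℤ) {α : ℝ} (hα : 1 ≤ α) :
    ∃ A : ℝ, 0 ≤ A ∧ ∀ {P Q : ℝ → 𝔼 → ℝ}, IsModePair β α n P Q → ∀ τ : ℝ, 0 ≤ τ → ∀ v : 𝔼,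
      |energyDensity β b n α P Q τ v| ≤ (6 + 2 * modeCorrector n b v ^ 2) * maxwellianBeta β v ∧
      |energyDensityDeriv β b n α P Q τ v| ≤
        4 * A * (2 + modeCorrector n b v ^ 2) * (collisionFrequency β v * maxwellianBeta β v) := by
  obtain ⟨a₀, ha₀, c, hc, hlow⟩ := exists_collisionFrequency_lowerBound (d := d) hd hβ
  have hlam := modeRate_nonneg hd hβ hb n
  set Cω : ℝ := ‖(modeVec n : 𝔼)‖ / c with hCω
  have hCω0 : 0 ≤ Cω := div_nonneg (norm_nonneg _) hc.le
  set A : ℝ := 2 * α ^ 2 + α * Cω + modeRate β b n / a₀ with hA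
  have hα0 : 0 < α := by linarith
  have hA0 : 0 ≤ A := by positivity
  refine ⟨A, hA0, fun {P Q} h τ hτ v => ?_⟩
  have ha := (hlow v).1
  have hav : 0 < collisionFrequency β v := ha₀.trans_le ha
  have hM := (maxwellianBeta_pos hβ v).le
  have hE1 : modeMult β b n τ ≤ 1 := modeMult_le_one hlam hτ
  have hE0 := (modeMult_pos β b n τ).le
  -- `|ω| ≤ Cω a`
  have hω : |modeFreq n v| ≤ Cω * collisionFrequency β v := by
    calc |modeFreq n v| ≤ ‖(modeVec n : 𝔼)‖ * ‖v‖ := abs_modeFreq_le n v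
      _ = Cω * (c * ‖v‖) := by rw [hCω]; field_simp
      _ ≤ Cω * collisionFrequency β v := mul_le_mul_of_nonneg_left (hlow v).2 hCω0
  -- `λ ≤ (λ/a₀) a`
  have hlama : modeRate β b n ≤ modeRate β b n / a₀ * collisionFrequency β v := by
    rw [div_mul_eq_mul_div, le_div_iff₀ ha₀]
    exact mul_le_mul_of_nonneg_left ha hlam
  have hP := h.abs_fst_le τ v
  have hQ := h.abs_snd_le τ v
  have hKP := abs_carlemanGain_le_of_bounded hd hβ (h.abs_fst_le τ) v
  have hKQ := abs_carlemanGain_le_of_bounded hd hβ (h.abs_snd_le τ) v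
  rw [one_mul] at hKP hKQ
  set a := collisionFrequency β v
  set wb := modeCorrector n b v
  -- `|p| ≤ 2`, `|q| ≤ 1 + |ω_b|`
  have hp : |devFst β b n P τ v| ≤ 2 := (h.abs_devFst_le (b := b) τ v).trans (by linarith)
  have hq : |devSnd β b n α Q τ v| ≤ 1 + |wb| := by
    refine (h.abs_devSnd_le (b := b) hα0 τ v).trans ?_
    have : modeMult β b n τ * |wb| / α ≤ |wb| := by
      rw [div_le_iff₀ hα0]
      calc modeMult β b n τ * |wb| ≤ 1 * |wb| := mul_le_mul_of_nonneg_right hE1 (abs_nonneg _)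
        _ = |wb| * 1 := by ring
        _ ≤ |wb| * α := mul_le_mul_of_nonneg_left hα (abs_nonneg _)
    linarith
  -- `|∂p| ≤ A a`
  have hdP : |derivFst β b n α P Q τ v| ≤ A * a := by
    unfold derivFst
    have t1 : |-(α ^ 2 * a) * P τ v| ≤ α ^ 2 * a := by
      rw [abs_mul, abs_neg, abs_of_nonneg (by positivity)]
      exact mul_le_of_le_one_right (by positivity) hP
    have t2 : |α * modeFreq n v * Q τ v| ≤ α * (Cω * a) := by
      rw [abs_mul, abs_mul, abs_of_pos hα0]
      calc α * |modeFreq n v| * |Q τ v| ≤ α * |modeFreq n v| * 1 := by gcongr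
        _ ≤ α * (Cω * a) := by rw [mul_one]; exact mul_le_mul_of_nonneg_left hω hα0.le
    have t3 : |α ^ 2 * carlemanGain β (P τ) v| ≤ α ^ 2 * a := by
      rw [abs_mul, abs_of_nonneg (by positivity)]; exact mul_le_mul_of_nonneg_left hKP (by positivity)
    have t4 : |modeRate β b n * modeMult β b n τ| ≤ modeRate β b n / a₀ * a := by
      rw [abs_mul, abs_of_nonneg hlam, abs_of_nonneg hE0]
      exact (mul_le_of_le_one_right hlam hE1).trans hlama
    calc |-(α ^ 2 * a) * P τ v + α * modeFreq n v * Q τ v + α ^ 2 * carlemanGain β (P τ) v +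
          modeRate β b n * modeMult β b n τ|
        ≤ |-(α ^ 2 * a) * P τ v| + |α * modeFreq n v * Q τ v| + |α ^ 2 * carlemanGain β (P τ) v| +
          |modeRate β b n * modeMult β b n τ| := by
          refine (abs_add_le _ _).trans (add_le_add ((abs_add_le _ _).trans (add_le_add (abs_add_le _ _) le_rfl)) le_rfl)
      _ ≤ α ^ 2 * a + α * (Cω * a) + α ^ 2 * a + modeRate β b n / a₀ * a := by linarith
      _ = A * a := by rw [hA]; ring
  -- `|∂q| ≤ A a (1 + |ω_b|)`
  have hdQ : |derivSnd β b n α P Q τ v| ≤ A * a * (1 + |wb|) := by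
    unfold derivSnd
    have t1 : |-(α ^ 2 * a) * Q τ v| ≤ α ^ 2 * a := by
      rw [abs_mul, abs_neg, abs_of_nonneg (by positivity)]
      exact mul_le_of_le_one_right (by positivity) hQ
    have t2 : |α * modeFreq n v * P τ v| ≤ α * (Cω * a) := by
      rw [abs_mul, abs_mul, abs_of_pos hα0]
      calc α * |modeFreq n v| * |P τ v| ≤ α * |modeFreq n v| * 1 := by gcongr
        _ ≤ α * (Cω * a) := by rw [mul_one]; exact mul_le_mul_of_nonneg_left hω hα0.le
    have t3 : |α ^ 2 * carlemanGain β (Q τ) v| ≤ α ^ 2 * a := by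
      rw [abs_mul, abs_of_nonneg (by positivity)]; exact mul_le_mul_of_nonneg_left hKQ (by positivity)
    have t4 : |modeRate β b n * modeMult β b n τ * wb / α| ≤ modeRate β b n / a₀ * a * |wb| := by
      rw [abs_div, abs_mul, abs_mul, abs_of_nonneg hlam, abs_of_nonneg hE0, abs_of_pos hα0, div_le_iff₀ hα0]
      have : modeRate β b n * modeMult β b n τ * |wb| ≤ modeRate β b n / a₀ * a * |wb| :=
        mul_le_mul_of_nonneg_right ((mul_le_of_le_one_right hlam hE1).trans hlama) (abs_nonneg _)
      exact this.trans (le_mul_of_one_le_right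
        (mul_nonneg (mul_nonneg (div_nonneg hlam ha₀.le) hav.le) (abs_nonneg wb)) hα)
    calc |-(α ^ 2 * a) * Q τ v - α * modeFreq n v * P τ v + α ^ 2 * carlemanGain β (Q τ) v -
          modeRate β b n * modeMult β b n τ * wb / α|
        ≤ |-(α ^ 2 * a) * Q τ v| + |α * modeFreq n v * P τ v| + |α ^ 2 * carlemanGain β (Q τ) v| +
          |modeRate β b n * modeMult β b n τ * wb / α| := by
          refine (abs_sub _ _).trans (add_le_add ((abs_add_le _ _).trans (add_le_add (abs_sub _ _) le_rfl)) le_rfl)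
      _ ≤ α ^ 2 * a + α * (Cω * a) + α ^ 2 * a + modeRate β b n / a₀ * a * |wb| := by linarith
      _ ≤ A * a * (1 + |wb|) := by
          have hx : 0 ≤ (2 * α ^ 2 + α * Cω) * a * |wb| := by positivity
          have hy : 0 ≤ modeRate β b n / a₀ * a := by positivity
          have e : A * a * (1 + |wb|) = (α ^ 2 * a + α * (Cω * a) + α ^ 2 * a + modeRate β b n / a₀ * a * |wb|) +
              ((2 * α ^ 2 + α * Cω) * a * |wb| + modeRate β b n / a₀ * a) := by
            rw [hA]; ring
          linarith
  have h3 : (1 + |wb|) ^ 2 ≤ 2 + 2 * wb ^ 2 := by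
    have h2wb : 2 * |wb| ≤ 1 + |wb| ^ 2 := by nlinarith [sq_nonneg (|wb| - 1)]
    rw [← sq_abs wb]
    nlinarith [h2wb]
  constructor
  · -- the density
    unfold energyDensity
    rw [abs_mul, abs_of_nonneg hM, abs_of_nonneg (by positivity)]
    refine mul_le_mul_of_nonneg_right ?_ hM
    have e1 : devFst β b n P τ v ^ 2 ≤ 4 := by
      have := pow_le_pow_left₀ (abs_nonneg _) hp 2
      rw [sq_abs] at this
      linarith
    have e2 : devSnd β b n α Q τ v ^ 2 ≤ (1 + |wb|) ^ 2 := by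
      have := pow_le_pow_left₀ (abs_nonneg _) hq 2
      rwa [sq_abs] at this
    linarith
  · -- the derivative
    unfold energyDensityDeriv
    rw [abs_mul, abs_mul, abs_of_nonneg hM, abs_two]
    have hin : |devFst β b n P τ v * derivFst β b n α P Q τ v + devSnd β b n α Q τ v * derivSnd β b n α P Q τ v| ≤
        2 * (A * a) + (1 + |wb|) * (A * a * (1 + |wb|)) := by
      refine (abs_add_le _ _).trans (add_le_add ?_ ?_)
      · rw [abs_mul]; exact mul_le_mul hp hdP (abs_nonneg _) (by norm_num)
      · rw [abs_mul]; exact mul_le_mul hq hdQ (abs_nonneg _) (by positivity)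
    have h1 : (1 + |wb|) * (A * a * (1 + |wb|)) ≤ A * a * (2 + 2 * wb ^ 2) := by
      calc (1 + |wb|) * (A * a * (1 + |wb|)) = A * a * (1 + |wb|) ^ 2 := by ring
        _ ≤ A * a * (2 + 2 * wb ^ 2) := mul_le_mul_of_nonneg_left h3 (mul_nonneg hA0 hav.le)
    calc 2 * |devFst β b n P τ v * derivFst β b n α P Q τ v + devSnd β b n α Q τ v * derivSnd β b n α P Q τ v| *
          maxwellianBeta β v
        ≤ 2 * (2 * (A * a) + (1 + |wb|) * (A * a * (1 + |wb|))) * maxwellianBeta β v := by gcongr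
      _ ≤ 2 * (2 * (A * a) + A * a * (2 + 2 * wb ^ 2)) * maxwellianBeta β v := by gcongr
      _ = 4 * A * (2 + wb ^ 2) * (a * maxwellianBeta β v) := by ring

/-- The dominating functions are integrable. [folklore] -/
theorem integrable_bounds (hd : 2 ≤ Fintype.card d) (hβ : 0 < β) {b : 𝔼 → 𝔼} (hb : IsDiffusionCorrector β b)
    (n : d → ℤ) (A : ℝ) :
    Integrable (fun v : 𝔼 => (6 + 2 * modeCorrector n b v ^ 2) * maxwellianBeta β v) ∧
    Integrable (fun v : 𝔼 => 4 * A * (2 + modeCorrector n b v ^ 2) *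
      (collisionFrequency β v * maxwellianBeta β v)) := by
  have hwb := finiteEnergy_modeCorrector hβ n hb
  have h1 := integrable_sq_mul_maxwellianBeta_of_finiteEnergy hd hβ hwb
  have h0 := KineticTheory.integrable_maxwellianBeta (d := d) hβ
  have ha := integrable_collisionFrequency_mul_maxwellianBeta (d := d) hβ
  constructor
  · exact ((h0.const_mul 6).add (h1.const_mul 2)).congr (Eventually.of_forall fun v => by
      simp only [Pi.add_apply]; ring)
  · exact (((ha.const_mul 2).add hwb.integrable).const_mul (4 * A)).congr
      (Eventually.of_forall fun v => by simp only [Pi.add_apply]; ring)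

/-- **The energy is continuous on `[0, T]`** (dominated convergence). [folklore] -/
theorem continuousOn_modeEnergy (hd : 2 ≤ Fintype.card d) (hβ : 0 < β) {b : 𝔼 → 𝔼}
    (hb : IsDiffusionCorrector β b) {n : d → ℤ} {α : ℝ} (hα : 1 ≤ α) {P Q : ℝ → 𝔼 → ℝ}
    (h : IsModePair β α n P Q) (T : ℝ) :
    ContinuousOn (modeEnergy β b n α P Q) (Icc 0 T) := by
  obtain ⟨A, -, hA⟩ := exists_bounds hd hβ hb n hα
  refine continuousOn_of_dominated (fun τ _ => (h.measurable_energyDensity (b := b) hβ hb τ).aestronglyMeasurable)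
    (fun τ hτ => Eventually.of_forall fun v => ?_) (integrable_bounds hd hβ hb n A).1
    (Eventually.of_forall fun v => ?_)
  · rw [Real.norm_eq_abs]; exact (hA h τ hτ.1 v).1
  · simp only [devFst, devSnd, modeMult]
    exact ((((h.fst_continuous v).sub (by fun_prop)).pow 2).add
      (((h.snd_continuous v).add (by fun_prop)).pow 2)).mul continuous_const |>.continuousOn

/-- **The energy is differentiable in `τ > 0`** with `y' = ∫ 2(p ∂p + q ∂q) M_β` (differentiation
under the integral sign, dominated by `4A(2 + ω_b²) a_β M_β`). [folklore] -/
theorem hasDerivAt_modeEnergy (hd : 2 ≤ Fintype.card d) (hβ : 0 < β) {b : 𝔼 → 𝔼}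
    (hb : IsDiffusionCorrector β b) {n : d → ℤ} {α : ℝ} (hα : 1 ≤ α) {P Q : ℝ → 𝔼 → ℝ}
    (h : IsModePair β α n P Q) {τ₀ : ℝ} (hτ₀ : 0 < τ₀) :
    HasDerivAt (modeEnergy β b n α P Q) (∫ v, energyDensityDeriv β b n α P Q τ₀ v) τ₀ := by
  obtain ⟨A, -, hA⟩ := exists_bounds hd hβ hb n hα
  have hs : Ioi (τ₀ / 2) ∈ 𝓝 τ₀ := Ioi_mem_nhds (by linarith)
  have key := hasDerivAt_integral_of_dominated_loc_of_deriv_le (μ := (volume : Measure 𝔼))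
    (F := fun τ v => energyDensity β b n α P Q τ v) (F' := fun τ v => energyDensityDeriv β b n α P Q τ v)
    (x₀ := τ₀) (bound := fun v => 4 * A * (2 + modeCorrector n b v ^ 2) *
      (collisionFrequency β v * maxwellianBeta β v)) hs
    (Eventually.of_forall fun τ => (h.measurable_energyDensity (b := b) hβ hb τ).aestronglyMeasurable)
    ?_ (h.measurable_energyDensityDeriv hβ hb τ₀).aestronglyMeasurable ?_ (integrable_bounds hd hβ hb n A).2 ?_
  · exact key.2
  · -- integrability of the density at `τ₀`
    refine (integrable_bounds hd hβ hb n A).1.mono' (h.measurable_energyDensity (b := b) hβ hb τ₀).aestronglyMeasurable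
      (Eventually.of_forall fun v => ?_)
    rw [Real.norm_eq_abs]; exact (hA h τ₀ hτ₀.le v).1
  · exact Eventually.of_forall fun v τ hτ => by
      have hτ' : τ₀ / 2 < τ := hτ
      rw [Real.norm_eq_abs]
      exact (hA h τ (by linarith) v).2
  · exact Eventually.of_forall fun v τ hτ => by
      have hτ' : τ₀ / 2 < τ := hτ
      exact h.hasDerivAt_energyDensity (b := b) v (by linarith)

/-! ### The differential inequality, Grönwall, and the energy estimate -/

/-- The initial energy: `y(0) = α⁻² ∫ ω_b² M_β`. [folklore] -/
theorem modeEnergy_zero {b : 𝔼 → 𝔼} {n : d → ℤ} {α : ℝ} {P Q : ℝ → 𝔼 → ℝ} (h : IsModePair β α n P Q) :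
    modeEnergy β b n α P Q 0 = (∫ v, modeCorrector n b v ^ 2 * maxwellianBeta β v) / α ^ 2 := by
  rw [modeEnergy, ← integral_div]
  refine integral_congr_ae (Eventually.of_forall fun v => ?_)
  simp only [devFst, devSnd, modeMult, h.fst_zero, h.snd_zero, mul_zero, neg_zero, Real.exp_zero]
  ring

/-- `2|xy| ≤ α x² + y²/α` for `α > 0`. [folklore] -/
theorem two_mul_abs_mul_le {α : ℝ} (hα : 0 < α) (x y : ℝ) : 2 * |x * y| ≤ α * x ^ 2 + y ^ 2 / α := by
  rw [abs_mul]
  have h : 0 ≤ (α * |x| - |y|) ^ 2 := sq_nonneg _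
  have e : α * x ^ 2 + y ^ 2 / α - 2 * (|x| * |y|) = (α * |x| - |y|) ^ 2 / α := by
    field_simp
    rw [← sq_abs x, ← sq_abs y]
    ring
  have : 0 ≤ α * x ^ 2 + y ^ 2 / α - 2 * (|x| * |y|) := by rw [e]; positivity
  linarith

/-- **The differential inequality**: for `τ > 0`,
`y'(τ) = ∫ 2(p ∂p + q ∂q) M_β ≤ λ y(τ) + (B(D,D)/2 + λ ∫ ω_b² M_β)/α²` — from the integrated energy
identity, dropping `-2α² B(q,q) ≤ 0`, absorbing `-2E B(D,p)` into `-2α² B(p,p)` by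
`|B(D,p)| ≤ ((2α²)⁻¹ B(D,D) + 2α² B(p,p))/2`, and bounding `(2λE/α) ∫ q ω_b M_β` by
`λ ∫ q² M_β + λ α⁻² ∫ ω_b² M_β`. [cite: BodineauGallagherSaintRaymondInvent2016, §6.1.3] -/
theorem integral_energyDensityDeriv_le (hd : 2 ≤ Fintype.card d) (hβ : 0 < β) {b : 𝔼 → 𝔼}
    (hb : IsDiffusionCorrector β b) {n : d → ℤ} {α : ℝ} (hα : 1 ≤ α) {P Q : ℝ → 𝔼 → ℝ}
    (h : IsModePair β α n P Q) {D : 𝔼 → ℝ} (hD : FiniteEnergy β D)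
    (hDeq : ∀ᵐ v : 𝔼, collisionFrequency β v * D v - carlemanGain β D v =
      modeFreq n v * modeCorrector n b v - modeRate β b n) {τ : ℝ} (hτ : 0 < τ) :
    ∫ v, energyDensityDeriv β b n α P Q τ v ≤
      modeRate β b n * modeEnergy β b n α P Q τ +
        (dirichletForm β D D / 2 + modeRate β b n * ∫ v, modeCorrector n b v ^ 2 * maxwellianBeta β v) / α ^ 2 := by
  have hα0 : 0 < α := by linarith
  have hlam := modeRate_nonneg hd hβ hb n
  have hE0 := (modeMult_pos β b n τ).le
  have hE1 : modeMult β b n τ ≤ 1 := modeMult_le_one hlam hτ.le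
  have hp := h.finiteEnergy_devFst (b := b) hβ τ
  have hq := h.finiteEnergy_devSnd hβ hb τ
  have hwb := finiteEnergy_modeCorrector hβ n hb
  -- `∫ F' = 2 × (the identity)`
  have e1 : ∫ v, energyDensityDeriv β b n α P Q τ v =
      2 * (-α ^ 2 * (dirichletForm β (devFst β b n P τ) (devFst β b n P τ) +
          dirichletForm β (devSnd β b n α Q τ) (devSnd β b n α Q τ)) -
        modeMult β b n τ * dirichletForm β D (devFst β b n P τ) -
        modeRate β b n * modeMult β b n τ / α *
          ∫ v, devSnd β b n α Q τ v * modeCorrector n b v * maxwellianBeta β v) := by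
    rw [← h.integral_energy_identity hd hβ hb hα0 hD hDeq τ, ← integral_const_mul]
    refine integral_congr_ae (Eventually.of_forall fun v => ?_)
    simp only [energyDensityDeriv, derivFst, derivSnd]
    ring
  rw [e1]
  set Dp := dirichletForm β (devFst β b n P τ) (devFst β b n P τ) with hDp_def
  set Dq := dirichletForm β (devSnd β b n α Q τ) (devSnd β b n α Q τ) with hDq_def
  set X := dirichletForm β D (devFst β b n P τ) with hX_def
  set I := ∫ v, devSnd β b n α Q τ v * modeCorrector n b v * maxwellianBeta β v with hI_def
  set W := ∫ v, modeCorrector n b v ^ 2 * maxwellianBeta β v with hW_def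
  set Y₂ := ∫ v, devSnd β b n α Q τ v ^ 2 * maxwellianBeta β v with hY₂_def
  set E := modeMult β b n τ with hE_def
  set lam := modeRate β b n with hlam_def
  have hDq : 0 ≤ Dq := dirichletForm_self_nonneg hd hβ hq
  have hDp : 0 ≤ Dp := dirichletForm_self_nonneg hd hβ hp
  -- absorption of the `D`-term
  have habs : |X| ≤ ((2 * α ^ 2)⁻¹ * dirichletForm β D D + (2 * α ^ 2) * Dp) / 2 := by
    have := abs_dirichletForm_le hd hβ hD hp (ε := (2 * α ^ 2)⁻¹) (by positivity)
    rwa [inv_inv] at this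
  have h1 : -(E * X) ≤ |X| := by
    calc -(E * X) = E * (-X) := by ring
      _ ≤ E * |X| := mul_le_mul_of_nonneg_left (neg_le_abs X) hE0
      _ ≤ 1 * |X| := mul_le_mul_of_nonneg_right hE1 (abs_nonneg _)
      _ = |X| := one_mul _
  -- the transport-corrector term
  have hI : |I| ≤ (α * Y₂ + W / α) / 2 := by
    have hint1 : Integrable fun v => devSnd β b n α Q τ v * modeCorrector n b v * maxwellianBeta β v :=
      hq.integrable_mul_mul_maxwellianBeta hwb hd hβ
    have hintq : Integrable fun v => devSnd β b n α Q τ v ^ 2 * maxwellianBeta β v :=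
      integrable_sq_mul_maxwellianBeta_of_finiteEnergy hd hβ hq
    have hintw : Integrable fun v => modeCorrector n b v ^ 2 * maxwellianBeta β v :=
      integrable_sq_mul_maxwellianBeta_of_finiteEnergy hd hβ hwb
    have hbound : Integrable fun v => (α * (devSnd β b n α Q τ v ^ 2 * maxwellianBeta β v) +
        (modeCorrector n b v ^ 2 * maxwellianBeta β v) / α) / 2 := ((hintq.const_mul α).add (hintw.div_const α)).div_const 2
    calc |I| ≤ ∫ v, |devSnd β b n α Q τ v * modeCorrector n b v * maxwellianBeta β v| := abs_integral_le_integral_abs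
      _ ≤ ∫ v, (α * (devSnd β b n α Q τ v ^ 2 * maxwellianBeta β v) +
            (modeCorrector n b v ^ 2 * maxwellianBeta β v) / α) / 2 := by
          refine integral_mono hint1.abs hbound fun v => ?_
          have hM := (maxwellianBeta_pos hβ v).le
          have := two_mul_abs_mul_le hα0 (devSnd β b n α Q τ v) (modeCorrector n b v)
          rw [abs_mul, abs_of_nonneg hM]
          have e : (α * (devSnd β b n α Q τ v ^ 2 * maxwellianBeta β v) +
              modeCorrector n b v ^ 2 * maxwellianBeta β v / α) / 2 =
              ((α * devSnd β b n α Q τ v ^ 2 + modeCorrector n b v ^ 2 / α) / 2) * maxwellianBeta β v := by ring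
          rw [e]
          exact mul_le_mul_of_nonneg_right (by linarith) hM
      _ = (α * Y₂ + W / α) / 2 := by
          rw [integral_div, integral_add (hintq.const_mul α) (hintw.div_const α), integral_const_mul, integral_div]
  have h2 : -(lam * E / α * I) ≤ lam / α * |I| := by
    have hc : 0 ≤ lam / α := div_nonneg hlam hα0.le
    calc -(lam * E / α * I) = lam / α * (E * (-I)) := by ring
      _ ≤ lam / α * (E * |I|) := mul_le_mul_of_nonneg_left (mul_le_mul_of_nonneg_left (neg_le_abs I) hE0) hc
      _ ≤ lam / α * (1 * |I|) := mul_le_mul_of_nonneg_left (mul_le_mul_of_nonneg_right hE1 (abs_nonneg _)) hc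
      _ = lam / α * |I| := by rw [one_mul]
  have h3 : lam / α * |I| ≤ lam * Y₂ / 2 + lam * W / (2 * α ^ 2) := by
    calc lam / α * |I| ≤ lam / α * ((α * Y₂ + W / α) / 2) := mul_le_mul_of_nonneg_left hI (div_nonneg hlam hα0.le)
      _ = lam * Y₂ / 2 + lam * W / (2 * α ^ 2) := by field_simp
  -- `∫ q² M ≤ y`
  have hY₂ : Y₂ ≤ modeEnergy β b n α P Q τ := by
    refine integral_mono (integrable_sq_mul_maxwellianBeta_of_finiteEnergy hd hβ hq)
      ((integrable_sq_mul_maxwellianBeta_of_finiteEnergy hd hβ hp).add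
        (integrable_sq_mul_maxwellianBeta_of_finiteEnergy hd hβ hq) |>.congr
        (Eventually.of_forall fun v => by simp only [Pi.add_apply]; ring)) fun v => ?_
    have hM := (maxwellianBeta_pos hβ v).le
    show devSnd β b n α Q τ v ^ 2 * maxwellianBeta β v ≤
      (devFst β b n P τ v ^ 2 + devSnd β b n α Q τ v ^ 2) * maxwellianBeta β v
    nlinarith [sq_nonneg (devFst β b n P τ v)]
  -- assemble
  have h4 : ((2 * α ^ 2)⁻¹ * dirichletForm β D D + (2 * α ^ 2) * Dp) / 2 =
      dirichletForm β D D / (4 * α ^ 2) + α ^ 2 * Dp := by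
    field_simp
    ring
  rw [h4] at habs
  have h5 : dirichletForm β D D / (4 * α ^ 2) * 2 + lam * W / (2 * α ^ 2) * 2 = (dirichletForm β D D / 2 + lam * W) / α ^ 2 := by
    field_simp
    ring
  have hlamY : lam * Y₂ ≤ lam * modeEnergy β b n α P Q τ := mul_le_mul_of_nonneg_left hY₂ hlam
  nlinarith [h1, h2, h3, habs, hDq, hDp, hlamY, h5, sq_nonneg α]

/-- `gronwallBound` is jointly continuous in the initial value and the time. [folklore] -/
theorem continuous_gronwallBound_uncurry (K ε : ℝ) :
    Continuous fun p : ℝ × ℝ => gronwallBound p.1 K ε p.2 := by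
  by_cases hK : K = 0
  · simp only [hK, gronwallBound_K0]
    fun_prop
  · simp only [gronwallBound_of_K_ne_0 hK]
    fun_prop

/-- `gronwallBound δ K ε x ≤ (δ + ε x) e^{Kx}` for `K, ε ≥ 0` (`e^{Kx} - 1 ≤ Kx e^{Kx}`).
[folklore] -/
theorem gronwallBound_le_mul_exp {δ K ε x : ℝ} (hK : 0 ≤ K) (hε : 0 ≤ ε) :
    gronwallBound δ K ε x ≤ (δ + ε * x) * Real.exp (K * x) := by
  by_cases hK0 : K = 0
  · rw [hK0, gronwallBound_K0]
    simp
  · rw [gronwallBound_of_K_ne_0 hK0]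
    have hKpos : 0 < K := lt_of_le_of_ne hK (Ne.symm hK0)
    have key : Real.exp (K * x) - 1 ≤ K * x * Real.exp (K * x) := by
      have h1 := Real.add_one_le_exp (-(K * x))
      have h2 : Real.exp (K * x) * Real.exp (-(K * x)) = 1 := by rw [← Real.exp_add]; simp
      nlinarith [Real.exp_pos (K * x), Real.exp_pos (-(K * x))]
    have h3 : ε / K * (Real.exp (K * x) - 1) ≤ ε * x * Real.exp (K * x) := by
      rw [div_mul_eq_mul_div, div_le_iff₀ hKpos]
      nlinarith [key, hε]
    simp only
    nlinarith [h3]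

/-- **The energy along the Hilbert expansion is controlled by Grönwall** (on `[0, T]`): with
`W = ∫ ω_b² M_β`, `y(τ) ≤ gronwallBound (W/α²) λ ((B(D,D)/2 + λW)/α²) τ` — Grönwall's inequality
on `[a, T]` for the differential inequality of `integral_energyDensityDeriv_le`, then `a → 0⁺` by
continuity. [cite: BodineauGallagherSaintRaymondInvent2016, §6.1.3] -/
theorem modeEnergy_le_gronwallBound (hd : 2 ≤ Fintype.card d) (hβ : 0 < β) {b : 𝔼 → 𝔼}
    (hb : IsDiffusionCorrector β b) {n : d → ℤ} {α : ℝ} (hα : 1 ≤ α) {P Q : ℝ → 𝔼 → ℝ}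
    (h : IsModePair β α n P Q) {D : 𝔼 → ℝ} (hD : FiniteEnergy β D)
    (hDeq : ∀ᵐ v : 𝔼, collisionFrequency β v * D v - carlemanGain β D v =
      modeFreq n v * modeCorrector n b v - modeRate β b n) {T : ℝ} :
    ∀ τ ∈ Icc 0 T, modeEnergy β b n α P Q τ ≤
      gronwallBound ((∫ v, modeCorrector n b v ^ 2 * maxwellianBeta β v) / α ^ 2) (modeRate β b n)
        ((dirichletForm β D D / 2 + modeRate β b n * ∫ v, modeCorrector n b v ^ 2 * maxwellianBeta β v) / α ^ 2) τ := by
  intro τ hτ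
  set y := modeEnergy β b n α P Q with hy_def
  set K := modeRate β b n with hK_def
  set εα := (dirichletForm β D D / 2 + modeRate β b n * ∫ v, modeCorrector n b v ^ 2 * maxwellianBeta β v) / α ^ 2
    with hεα_def
  have hy0 : y 0 = (∫ v, modeCorrector n b v ^ 2 * maxwellianBeta β v) / α ^ 2 := h.modeEnergy_zero
  rcases hτ.1.eq_or_lt with hτ0 | hτpos
  · rw [← hτ0, ← hy0]
    by_cases hK0 : K = 0
    · rw [hK0, gronwallBound_K0]; simp
    · rw [gronwallBound_of_K_ne_0 hK0]; simp
  have hcont := h.continuousOn_modeEnergy hd hβ hb hα T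
  -- Grönwall on `[a, T]`, `0 < a ≤ τ`
  have hG : ∀ a, 0 < a → a ≤ τ → y τ ≤ gronwallBound (y a) K εα (τ - a) := by
    intro a ha haτ
    have hmain := le_gronwallBound_of_liminf_deriv_right_le (f := y)
      (f' := fun x => ∫ v, energyDensityDeriv β b n α P Q x v) (δ := y a) (K := K) (ε := εα) (a := a) (b := T)
      (hcont.mono (Icc_subset_Icc ha.le le_rfl)) ?_ le_rfl ?_
    · exact hmain τ ⟨haτ, hτ.2⟩
    · intro x hx r hr
      have hxpos : 0 < x := ha.trans_le hx.1
      have hd' := (h.hasDerivAt_modeEnergy hd hβ hb hα hxpos).hasDerivWithinAt (s := Ici x)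
      exact (hd'.liminf_right_slope_le hr).mono fun z hz => by rwa [slope_def_module, smul_eq_mul] at hz
    · intro x hx
      exact h.integral_energyDensityDeriv_le hd hβ hb hα hD hDeq (ha.trans_le hx.1)
  -- the limit `a → 0⁺`
  have hT : (0 : ℝ) < T := hτpos.trans_le hτ.2
  have hylim : Tendsto y (𝓝[>] 0) (𝓝 (y 0)) := by
    have hcw : ContinuousWithinAt y (Icc 0 T) 0 := hcont 0 ⟨le_rfl, hT.le⟩
    have hle : 𝓝[>] (0 : ℝ) ≤ 𝓝[Icc 0 T] 0 := by
      rw [← nhdsWithin_Ioc_eq_nhdsGT hT]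
      exact nhdsWithin_mono _ Ioc_subset_Icc_self
    exact hcw.tendsto.mono_left hle
  have hlim : Tendsto (fun a => gronwallBound (y a) K εα (τ - a)) (𝓝[>] 0) (𝓝 (gronwallBound (y 0) K εα τ)) := by
    have hcg := (continuous_gronwallBound_uncurry K εα).continuousAt (x := (y 0, τ))
    have hsub : Tendsto (fun a : ℝ => τ - a) (𝓝[>] 0) (𝓝 τ) := by
      have : Tendsto (fun a : ℝ => τ - a) (𝓝 0) (𝓝 (τ - 0)) := (continuous_const.sub continuous_id).tendsto 0
      rw [sub_zero] at this
      exact this.mono_left nhdsWithin_le_nhds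
    exact hcg.tendsto.comp (hylim.prodMk_nhds hsub)
  have hev : ∀ᶠ a in 𝓝[>] (0 : ℝ), y τ ≤ gronwallBound (y a) K εα (τ - a) := by
    filter_upwards [Ioo_mem_nhdsGT hτpos] with a ha using hG a ha.1 ha.2.le
  have := ge_of_tendsto hlim hev
  rwa [hy0] at this

/-- **The energy estimate for the Hilbert expansion on one Fourier mode.** For `d ≥ 2`, `β > 0`,
a diffusion corrector `b` (6.5), a frequency `n` and a horizon `T ≥ 0` there is `C = C(d, β, b, n, T)`
such that for every `α ≥ 1` and every solution `G = P + iQ` of the rescaled mode equation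
`∂_τ G = -(α² a_β + i α ω) G + α² K⁺_β G`, `G(0) = 1`, `|G| ≤ 1` (`IsModePair`),
`‖G(τ) - e^{-λτ}(1 - i α⁻¹ ω_b)‖²_{L²(M_β)} ≤ C / α²` for all `τ ∈ [0, T]`
(`C = (W + (B(D,D)/2 + λW) T) e^{λT}`, `W = ∫ ω_b² M_β`, `λ = 4π² κ_β |n|²`): the rescaled mode
amplitude stays `O(α⁻¹)`-close in `L²(M_β dv)` to the Hilbert expansion of BGSR §6.1.2, whose
leading term is the heat multiplier `e^{-4π² κ_β |n|² τ}` of the mode.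
[cite: BodineauGallagherSaintRaymondInvent2016, §6.1.2–6.1.3 and (6.3)] -/
theorem modeEnergy_le (hd : 2 ≤ Fintype.card d) (hβ : 0 < β) {b : 𝔼 → 𝔼}
    (hb : IsDiffusionCorrector β b) (n : d → ℤ) {T : ℝ} (hT : 0 ≤ T) :
    ∃ C : ℝ, 0 ≤ C ∧ ∀ α : ℝ, 1 ≤ α → ∀ P Q : ℝ → 𝔼 → ℝ, IsModePair β α n P Q →
      ∀ τ ∈ Icc 0 T, modeEnergy β b n α P Q τ ≤ C / α ^ 2 := by
  obtain ⟨D, hD, -, hDeq⟩ := exists_secondModeCorrector hd hβ n hb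
  set W := ∫ v, modeCorrector n b v ^ 2 * maxwellianBeta β v with hW_def
  set K := modeRate β b n with hK_def
  have hW : 0 ≤ W := integral_nonneg fun v => mul_nonneg (sq_nonneg _) (maxwellianBeta_pos hβ v).le
  have hK : 0 ≤ K := modeRate_nonneg hd hβ hb n
  have hDD : 0 ≤ dirichletForm β D D := dirichletForm_self_nonneg hd hβ hD
  refine ⟨(W + (dirichletForm β D D / 2 + K * W) * T) * Real.exp (K * T), by positivity, ?_⟩
  intro α hα P Q h τ hτ
  have hα0 : 0 < α := by linarith
  have hG := h.modeEnergy_le_gronwallBound hd hβ hb hα hD hDeq τ hτ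
  refine hG.trans ?_
  have hB : 0 ≤ dirichletForm β D D / 2 + K * W := by positivity
  refine (gronwallBound_le_mul_exp hK (by positivity)).trans ?_
  have h1 : W + (dirichletForm β D D / 2 + K * W) * τ ≤ W + (dirichletForm β D D / 2 + K * W) * T := by
    nlinarith [hτ.2]
  have h2 : Real.exp (K * τ) ≤ Real.exp (K * T) := Real.exp_le_exp.2 (mul_le_mul_of_nonneg_left hτ.2 hK)
  have h0 : 0 ≤ W + (dirichletForm β D D / 2 + K * W) * τ := by nlinarith [hτ.1]
  calc (W / α ^ 2 + (dirichletForm β D D / 2 + K * W) / α ^ 2 * τ) * Real.exp (K * τ)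
      = (W + (dirichletForm β D D / 2 + K * W) * τ) * Real.exp (K * τ) / α ^ 2 := by ring
    _ ≤ (W + (dirichletForm β D D / 2 + K * W) * T) * Real.exp (K * T) / α ^ 2 := by
        gcongr

end IsModePair

end ModePair

end

end Literature.MathematicalPhysics.KineticTheory
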